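import Literature.Analysis.FluidPDE.TaoCascadeZeroScaleTauOne
import Literature.Analysis.FluidPDE.TaoCascadeCoarseSecondary
import Literature.Analysis.FluidPDE.TaoCascadeCoarseNoExit
import Literature.Analysis.FluidPDE.TaoCascadeRotorAveraging
import HarnessLib

/-!
# Tao's cascade ODE, §6.7: Prop. 6.17 (no exit to coarse scales) in the parameter regime

T. Tao, *Finite time blowup for an averaged three-dimensional Navier–Stokes equation*,
J. Amer. Math. Soc. **29** (2016), 601–674 = arXiv:1402.0290v3, §6.7, Prop. 6.17 and its proof
((6.168)–(6.179); display numbers of arXiv v3, authoritative locator: Prop. 6.17).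

**Prop. 6.17** ("No exit to coarse scales"): `Ẽ₋₁(t) ≲ K⁻¹⁴` for `t_c ≤ t ≤ τ₁`; "in particular, by
Proposition 6.16 we have (6.175) `τ₁ = t_c + K^{-1/2}` and hence the interval `I = [t_c + K⁻⁹, τ₁]`
is non-empty", and the error of the `a₀`-equation improves to (6.179). The printed proof: bounds
(6.168)–(6.173) on the secondary coarse modes `b₋₁, c₋₁` on `[0, τ₁]`; the modified energy
`E* := Ẽ₋₁ - ½(1+ε₀)^{5/2}K a₋₁d₋₁(ε²/c₋₁)a₀` with (6.178) `E* = Ẽ₋₁ + O(K⁻¹⁰⁰)` and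
`∂ₜE* ≤ -½K(1+ε₀)^{-5/2}E* a₀ + O(K⁻¹⁴)` (Lemma 6.9); Grönwall.

This file proves the proposition over the standing hypotheses of §6.7 in the explicit parameter
regime, `ZeroScale.Setting` (`TaoCascadeZeroScaleCritical.lean`), first on an abstract interval
`[t⋆, t₂]` with the zero-scale inputs the printed proof quotes entering as hypotheses
(`Setting.F_negOne_le_of_osc`: `a₀ ≥ 0` and `|c₀| ≤ K⁻¹⁰ε²` on `[0, t⋆]`, `t⋆ ≥ 1/2`, `t₂ ≤ 3`, the
upper bound (6.167) in the form `|c₀| ≤ ε² exp(10⁻⁸K¹⁰)` on `[t⋆, t₂]`, and a lower bound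
`-λ ≤ ∫ₛᵗ a₀`, `Kλ ≤ 1`, for `t⋆ ≤ s ≤ t ≤ t₂` — what Grönwall's inequality with the *signed* rate
`-K a₀(t)` needs where `a₀` oscillates; `Setting.abs_integral_a_zero_le_of_rotor` derives it from
(6.165) `c₀ ≥ K²⁰ε²` and (6.181) `|∂ₜc₀| ≤ L₀c₀` by the rotor-averaging lemma `integral_rotor_le`),
and then on the rotor phase `[t_c, τ₁]` itself (`Setting.F_negOne_le_rotor_phase`), all inputs
being discharged from `TaoCascadeZeroScaleCritical.lean` (`t_c`, (6.151), (6.153), (6.156)) and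
`TaoCascadeZeroScaleTauOne.lean` (`τ₁`, (6.165), (6.167), (6.181), Prop. 6.16) under the additional
largeness `K ≥ 10¹⁸` — the "mismatch in speeds between the `0`-scale and `-1`-scale dynamics"
(`c₀ ≤ 2K⁻¹⁰ε² exp(4K¹⁰K^{-1/2})` against `c₋₁ ≥ exp(6·10⁻⁸K¹⁰)ε²`) needs `√K ≥ 4·10⁸`, beyond the
`K ≥ 10⁶` of `ZeroScale.Regime`. Contents (constants explicit; `t₂ ≤ min T 3`, `N > n₀` where the
scale `-1` carries data):

* `Setting.coarse_b_le`, `coarse_c_abs_le_regime`, `coarse_b_ge`, `coarse_b_abs_le`,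
  `coarse_c_ge_exp`, `coarse_c_ge_expK9`, `coarse_c_ge_late`, `coarse_dc_le` — (6.168)–(6.173) on
  `[0, t₂]`: `b₋₁ ≤ 2·10⁵ε`, `|c₋₁| ≤ exp(7·10⁵K¹⁰)ε²`, `b₋₁ ≥ 10⁻⁶ε`,
  `c₋₁ ≥ exp(K¹⁰t/(8·10⁶))·exp(K⁹)ε²/2` (`≥ exp(6·10⁻⁸K¹⁰)ε²` for `t ≥ 1/2`),
  `|∂ₜc₋₁| ≤ (2·10⁵K¹⁰ + 1)c₋₁`;
* `coarseRho`, `coarseCorr`, `coarseEnergy`, `coarseCorrDeriv`, `coarseEnergyDeriv` — `ρ`, the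
  correction, `E*` and their one-sided derivatives (`Setting.hasDerivWithinAt_coarseEnergy`);
  `Setting.coarseEnergyDeriv_le_of/_le` — `∂ₜE* ≤ -K a₀ E* + 10K⁻¹⁴` (via the pointwise algebra
  `coarseModifiedEnergy_algebra`, `coarse_rate_algebra` of `TaoCascadeCoarseNoExit.lean`);
* `Setting.F_negOne_le_of_osc`, `F_negOne_le_of_rotor`, `F_negOne_lt_exit_of_osc` — Prop. 6.17 on
  `[t⋆, t₂]`: `Ẽ₋₁ ≤ 100K⁻¹⁴ < K⁻¹⁰(1+ε₀)^{2/10}`;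
* `Setting.F_negOne_le_rotor_phase`, `F_negOne_lt_exit_rotor_phase`, `τone_eq`, `tc_add_lt_τone`,
  `da_zero_rotor_phase` — **Prop. 6.17 on `[t_c, τ₁]`**, **(6.175) `τ₁ = t_c + K^{-1/2}`**,
  `I ≠ ∅`, and (6.179) `|∂ₜa₀ + ε⁻²c₀d₀| ≤ 210K⁻¹³` there (the printed `O(K⁻¹⁴)` is `2KẼ₋₁`-sharp
  only up to the factor `K`), for `K ≥ 10¹⁸`.

One simplification relative to the printed argument: the hypothesis (6.59) `Ẽ₋₁(0) ≤ K⁻²⁰` of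
Prop. 6.5 (rather than the bootstrap bound `Ẽ₋₁(0) ≲ K⁻¹⁰` quoted in (6.176)) is already below the
target `K⁻¹⁴`, so no decay of `E*` has to be extracted from `∫₀ᵗ a₀ ≳ 1`; only the sign control of
`∫ₛᵗ a₀` is used. The case `N = n₀` is trivial by (6.52) (no very low frequencies). A stand-alone
form of the `E*` argument with free levels is `RescaledHypotheses.coarse_energy_bound`
(`TaoCascadeCoarseEnergy.lean`); the present file is its resolution in the regime.

## References

* T. Tao, J. Amer. Math. Soc. 29 (2016), 601–674 = arXiv:1402.0290v3, §6.4 Prop. 6.5 (6.52),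
  (6.59)–(6.63); §6.5 Lemma 6.9; §6.6 (6.134)–(6.137); §6.7 Props. 6.16, 6.17, (6.165)–(6.181).
  [`Tao2016AveragedNS`]
-/

noncomputable section

open Set MeasureTheory intervalIntegral Filter Topology

namespace Literature.Analysis.FluidPDE

namespace TaoCascade

namespace ZeroScale

open Literature.Analysis.ODE

/-! ## Numerical facts in the regime -/

section Numerics

variable {ε₀ K ε C₁ C₂ C₄ C₅ : ℝ} {n₀ : ℤ}

/-- `exp(-c) ≤ K⁻ⁿ` as soon as `n K ≤ c` (`K ≥ 0`). [folklore] -/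
theorem exp_neg_le_inv_pow {K c : ℝ} (hK : 0 < K) (n : ℕ) (hc : (n : ℝ) * K ≤ c) :
    Real.exp (-c) ≤ (K ^ n)⁻¹ := by
  rw [Real.exp_neg]
  exact inv_anti₀ (pow_pos hK n) ((pow_le_exp_mul hK.le n).trans (Real.exp_le_exp.2 hc))

/-- `exp(-K⁹) ≤ K⁻⁴⁰` for `K ≥ 10⁶`. [folklore] -/
theorem Regime.exp_neg_K9_le (hr : Regime ε₀ K ε C₁ C₂ C₄ C₅ n₀) :
    Real.exp (-K ^ 9) ≤ (K ^ 40)⁻¹ := by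
  apply exp_neg_le_inv_pow hr.K_pos 40
  have hK := hr.K_large
  have h8 : (40 : ℝ) ≤ K ^ 8 := by
    calc (40 : ℝ) ≤ 10 ^ 6 := by norm_num
      _ ≤ K := hK
      _ = K ^ 1 := (pow_one K).symm
      _ ≤ K ^ 8 := pow_le_pow_right₀ hr.one_le_K (by norm_num)
  calc (40 : ℕ) * K = 40 * K := by norm_num
    _ ≤ K ^ 8 * K := by gcongr
    _ = K ^ 9 := by ring

/-- `exp(-(5/10⁸) K¹⁰) ≤ K⁻⁴⁰` for `K ≥ 10⁶`. [folklore] -/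
theorem Regime.exp_neg_small_K10_le (hr : Regime ε₀ K ε C₁ C₂ C₄ C₅ n₀) :
    Real.exp (-(5 / 10 ^ 8 * K ^ 10)) ≤ (K ^ 40)⁻¹ := by
  apply exp_neg_le_inv_pow hr.K_pos 40
  have hK := hr.K_large
  have h9 : (40 : ℝ) * 10 ^ 8 / 5 ≤ K ^ 9 := by
    calc (40 : ℝ) * 10 ^ 8 / 5 ≤ (10 ^ 6) ^ 9 := by norm_num
      _ ≤ K ^ 9 := pow_le_pow_left₀ (by norm_num) hK 9
  have hK0 := hr.K_pos.le
  calc ((40 : ℕ) : ℝ) * K = 40 * K := by norm_num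
    _ = 5 / 10 ^ 8 * (40 * 10 ^ 8 / 5) * K := by ring
    _ ≤ 5 / 10 ^ 8 * K ^ 9 * K := by gcongr
    _ = 5 / 10 ^ 8 * K ^ 10 := by ring

/-- `K⁻⁴⁰ · c ≤ K⁻³⁰` for `0 ≤ c ≤ K¹⁰`. [folklore] -/
theorem Regime.inv_K40_mul_le (hr : Regime ε₀ K ε C₁ C₂ C₄ C₅ n₀) {c : ℝ} (hc : c ≤ K ^ 10) :
    (K ^ 40)⁻¹ * c ≤ (K ^ 30)⁻¹ := by
  have hK := hr.K_pos
  rw [inv_mul_le_iff₀ (pow_pos hK 40)]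
  calc c ≤ K ^ 10 := hc
    _ = K ^ 40 * (K ^ 30)⁻¹ := by field_simp

/-- `10⁷ K¹¹ ≤ K¹⁰ · K¹⁰`-type absorption: `10⁷ K² ≤ K¹⁰` for `K ≥ 10⁶`. [folklore] -/
theorem Regime.ten7_K2_le (hr : Regime ε₀ K ε C₁ C₂ C₄ C₅ n₀) : 10 ^ 7 * K ^ 2 ≤ K ^ 10 := by
  have hK := hr.K_large
  have h1 := hr.one_le_K
  have h8 : (10 : ℝ) ^ 7 ≤ K ^ 8 := by
    calc (10 : ℝ) ^ 7 ≤ (10 ^ 6) ^ 8 := by norm_num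
      _ ≤ K ^ 8 := pow_le_pow_left₀ (by norm_num) hK 8
  calc 10 ^ 7 * K ^ 2 ≤ K ^ 8 * K ^ 2 := by gcongr
    _ = K ^ 10 := by ring

/-- `K⁻ⁿ ≤ 10⁻⁶` for `n ≥ 1` and `K ≥ 10⁶`. [folklore] -/
theorem Regime.inv_K_pow_le_inv_ten6 (hr : Regime ε₀ K ε C₁ C₂ C₄ C₅ n₀) {n : ℕ} (hn : 1 ≤ n) :
    (K ^ n)⁻¹ ≤ 1 / 10 ^ 6 := by
  calc (K ^ n)⁻¹ ≤ (K ^ 1)⁻¹ := hr.inv_pow_anti hn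
    _ ≤ (10 ^ 6)⁻¹ := by rw [pow_one]; exact inv_anti₀ (by norm_num) hr.K_large
    _ = 1 / 10 ^ 6 := by norm_num

/-- `ε² exp(c K¹⁰) ≤ exp(-(2·10⁶ - c) K¹⁰)` from `ε ≤ exp(-10⁶K¹⁰)`. [folklore] -/
theorem Regime.ε_sq_mul_exp_le (hr : Regime ε₀ K ε C₁ C₂ C₄ C₅ n₀) (hε : 0 < ε) (c : ℝ) :
    ε ^ 2 * Real.exp (c * K ^ 10) ≤ Real.exp (-(2 * 10 ^ 6 - c) * K ^ 10) := by
  have h := hr.ε_le_exp hε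
  calc ε ^ 2 * Real.exp (c * K ^ 10)
      ≤ (Real.exp (-(10 ^ 6 * K ^ 10))) ^ 2 * Real.exp (c * K ^ 10) := by gcongr
    _ = Real.exp (-(2 * 10 ^ 6 - c) * K ^ 10) := by
        rw [← Real.exp_nat_mul, ← Real.exp_add]; congr 1; push_cast; ring

/-- `ε exp(c K¹⁰) ≤ exp(-(10⁶ - c) K¹⁰)`. [folklore] -/
theorem Regime.ε_mul_exp_le (hr : Regime ε₀ K ε C₁ C₂ C₄ C₅ n₀) (hε : 0 < ε) (c : ℝ) :
    ε * Real.exp (c * K ^ 10) ≤ Real.exp (-(10 ^ 6 - c) * K ^ 10) := by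
  have h := hr.ε_le_exp hε
  calc ε * Real.exp (c * K ^ 10)
      ≤ Real.exp (-(10 ^ 6 * K ^ 10)) * Real.exp (c * K ^ 10) := by gcongr
    _ = Real.exp (-(10 ^ 6 - c) * K ^ 10) := by rw [← Real.exp_add]; congr 1; ring

/-- `exp(-c K¹⁰) ≤ K⁻⁴⁰` whenever `c ≥ 1`. [folklore] -/
theorem Regime.exp_neg_mul_K10_le (hr : Regime ε₀ K ε C₁ C₂ C₄ C₅ n₀) {c : ℝ} (hc : 1 ≤ c) :
    Real.exp (-(c * K ^ 10)) ≤ (K ^ 40)⁻¹ := by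
  refine le_trans ?_ hr.exp_neg_small_K10_le
  apply Real.exp_le_exp.2
  have := pow_nonneg hr.K_pos.le 10
  nlinarith

/-- `(1+ε₀)^{-2-n₀/2} ≤ (1+ε₀)^{-n₀/2}`. [folklore] -/
theorem rpow_neg_two_sub_le {ε₀ : ℝ} (hε₀ : 0 < ε₀) (n₀ : ℤ) :
    (1 + ε₀) ^ (-2 - (n₀ : ℝ) / 2) ≤ (1 + ε₀) ^ (-(n₀ : ℝ) / 2) := by
  apply Real.rpow_le_rpow_of_exponent_le (by linarith)
  linarith

end Numerics

/-! ## The secondary coarse modes `b₋₁, c₋₁` in the regime ((6.168)–(6.173)) -/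

section Secondary

variable {ε₀ K ε C₁ C₂ C₃ C₄ C₅ : ℝ} {n₀ N : ℤ} {τ : ℤ → ℝ} {Y : Fin 4 → ℤ → ℝ → ℝ}
  {F : ℤ → ℝ → ℝ} {T : ℝ}

/-- The two spellings `-(5/2)` and `-5/2` of the exponent agree. [folklore] -/
theorem rpow_neg_five_halves (q : ℝ) : q ^ (-((5 : ℝ) / 2)) = q ^ (-(5 : ℝ) / 2) := by
  congr 1; ring

/-- `(1+ε₀)^{-5/2} ≤ 1`. [folklore] -/
theorem Setting.Q_le_one (hs : Setting ε₀ K ε C₁ C₂ C₃ C₄ C₅ n₀ N τ Y F T) :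
    (1 + ε₀) ^ (-((5 : ℝ) / 2)) ≤ 1 := by
  rw [rpow_neg_five_halves]; exact hs.qm52_le

/-- `1/8 ≤ (1+ε₀)^{-5/2}`. [folklore] -/
theorem Setting.Q_ge (hs : Setting ε₀ K ε C₁ C₂ C₃ C₄ C₅ n₀ N τ Y F T) :
    1 / 8 ≤ (1 + ε₀) ^ (-((5 : ℝ) / 2)) := by
  rw [rpow_neg_five_halves]; exact hs.qm52_ge

/-- `0 < (1+ε₀)^{-5/2}`. [folklore] -/
theorem Setting.Q_pos (hs : Setting ε₀ K ε C₁ C₂ C₃ C₄ C₅ n₀ N τ Y F T) :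
    0 < (1 + ε₀) ^ (-((5 : ℝ) / 2)) := Real.rpow_pos_of_pos hs.q_pos _

/-- The viscosity error at scale `-1` with `E₁ = 2K⁻¹⁰`: `η := C₁(1+ε₀)^{-2-n₀/2}√(2K⁻¹⁰) ≤ ε⁴e^{-10K¹⁰}`.
[cite: Tao2016AveragedNS, §6.7] -/
theorem Setting.eta_le (hs : Setting ε₀ K ε C₁ C₂ C₃ C₄ C₅ n₀ N τ Y F T) :
    C₁ * (1 + ε₀) ^ (-2 - (n₀ : ℝ) / 2) * Real.sqrt (2 * (K ^ 10)⁻¹) ≤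
      ε ^ 4 * Real.exp (-10 * K ^ 10) := by
  have h1 : Real.sqrt (2 * (K ^ 10)⁻¹) ≤ 1 := by
    rw [show (1 : ℝ) = Real.sqrt 1 by simp]
    apply Real.sqrt_le_sqrt
    have := hs.inv_K_pow_le_half (n := 10) (by norm_num)
    linarith
  have h2 := rpow_neg_two_sub_le hs.ε₀_pos n₀
  have hC₁ := hs.C₁_nn
  have h0 : 0 ≤ (1 + ε₀) ^ (-(n₀ : ℝ) / 2) := Real.rpow_nonneg hs.q_pos.le _
  calc C₁ * (1 + ε₀) ^ (-2 - (n₀ : ℝ) / 2) * Real.sqrt (2 * (K ^ 10)⁻¹)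
      ≤ C₁ * (1 + ε₀) ^ (-(n₀ : ℝ) / 2) * 1 := by gcongr
    _ = C₁ * (1 + ε₀) ^ (-(n₀ : ℝ) / 2) := mul_one _
    _ ≤ _ := hs.ρ_le

/-- `η ≤ ε⁴` and `η ≤ ε²/4`-type consequences: `ε⁴ e^{-10K¹⁰} ≤ ε⁴ ≤ ε²`. [folklore] -/
theorem Setting.late_le_ε_sq (hs : Setting ε₀ K ε C₁ C₂ C₃ C₄ C₅ n₀ N τ Y F T) :
    ε ^ 4 * Real.exp (-10 * K ^ 10) ≤ ε ^ 2 * (K ^ 100)⁻¹ := by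
  have hε := hs.ε_pos
  have hε1 := hs.ε_le_one hε
  have hεK := hs.ε_le_K100
  have h2 : Real.exp (-10 * K ^ 10) ≤ 1 := by
    rw [Real.exp_le_one_iff]; have := pow_nonneg hs.K_pos.le 10; linarith
  calc ε ^ 4 * Real.exp (-10 * K ^ 10) ≤ ε ^ 4 * 1 := by gcongr
    _ = ε ^ 2 * (ε * ε) := by ring
    _ ≤ ε ^ 2 * ((K ^ 100)⁻¹ * 1) := by gcongr
    _ = _ := by ring

/-- `0 ≤ η`. [folklore] -/
theorem Setting.eta_nonneg (hs : Setting ε₀ K ε C₁ C₂ C₃ C₄ C₅ n₀ N τ Y F T) :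
    0 ≤ C₁ * (1 + ε₀) ^ (-2 - (n₀ : ℝ) / 2) * Real.sqrt (2 * (K ^ 10)⁻¹) :=
  mul_nonneg (mul_nonneg hs.C₁_nn (Real.rpow_nonneg hs.q_pos.le _)) (Real.sqrt_nonneg _)

/-- `Ẽ₋₁ ≤ 2K⁻¹⁰` on `[0, t₂]` for `t₂ ≤ T`. [cite: Tao2016AveragedNS, §6.7] -/
theorem Setting.F_negOne_le_on (hs : Setting ε₀ K ε C₁ C₂ C₃ C₄ C₅ n₀ N τ Y F T) {t₂ : ℝ}
    (ht₂ : t₂ ≤ T) : ∀ t ∈ Icc 0 t₂, F (-1) t ≤ 2 * (K ^ 10)⁻¹ :=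
  fun _ ht => hs.F_negOne_le ⟨ht.1, ht.2.trans ht₂⟩

/-- **(6.168) in the regime**: for `N > n₀`, `b₋₁ ≤ 2·10⁵ ε` on `[0, t₂]`, `t₂ ≤ min T 3`
(from (6.61) `b₋₁(0) ≤ 10⁵ε`). [cite: Tao2016AveragedNS, §6.7 (6.168)] -/
theorem Setting.coarse_b_le (hs : Setting ε₀ K ε C₁ C₂ C₃ C₄ C₅ n₀ N τ Y F T) (hN : n₀ < N)
    {t₂ : ℝ} (ht₂ : t₂ ≤ T) (ht₂3 : t₂ ≤ 3) {t : ℝ} (ht : t ∈ Icc 0 t₂) :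
    Y 1 (-1) t ≤ 2 * 10 ^ 5 * ε := by
  have hε := hs.ε_pos
  have hK := hs.K_pos
  have h := hs.hyp.coarse_b_upper hε hs.C₁_nn hs.ε₀_pos hs.τ₀_le (hs.F_negOne_le_on ht₂) ht
  have hb0 := hs.hyp.b_prev_le hN
  have hQ := hs.Q_le_one
  have hQ0 := hs.Q_pos
  have hη := hs.eta_le.trans (hs.late_le_ε hε)
  have hK10 : (K ^ 10)⁻¹ ≤ 1 / 2 := hs.inv_K_pow_le_half (by norm_num)
  have hrate : (1 + ε₀) ^ (-((5 : ℝ) / 2)) * (2 * ε * (2 * (K ^ 10)⁻¹)) +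
      C₁ * (1 + ε₀) ^ (-2 - (n₀ : ℝ) / 2) * Real.sqrt (2 * (K ^ 10)⁻¹) ≤ 3 * ε := by
    have : (1 + ε₀) ^ (-((5 : ℝ) / 2)) * (2 * ε * (2 * (K ^ 10)⁻¹)) ≤ 1 * (2 * ε * (2 * (1 / 2))) := by
      gcongr
    linarith
  have ht0 := ht.1
  have ht3 : t ≤ 3 := ht.2.trans ht₂3
  calc Y 1 (-1) t ≤ Y 1 (-1) 0 + ((1 + ε₀) ^ (-((5 : ℝ) / 2)) * (2 * ε * (2 * (K ^ 10)⁻¹)) +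
        C₁ * (1 + ε₀) ^ (-2 - (n₀ : ℝ) / 2) * Real.sqrt (2 * (K ^ 10)⁻¹)) * t := h
    _ ≤ 10 ^ 5 * ε + 3 * ε * 3 := by gcongr
    _ ≤ 2 * 10 ^ 5 * ε := by linarith

/-- **(6.169) in the regime**: for `N > n₀`, `|c₋₁| ≤ exp(7·10⁵ K¹⁰) ε²` on `[0, t₂]`, `t₂ ≤ min T 3`
(Grönwall with the rate `(1+ε₀)^{-5/2}ε⁻¹K¹⁰ · 2·10⁵ε`, from (6.63) `c₋₁(0) ≤ exp(K¹⁰)ε²`).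
[cite: Tao2016AveragedNS, §6.7 (6.169)] -/
theorem Setting.coarse_c_abs_le_regime (hs : Setting ε₀ K ε C₁ C₂ C₃ C₄ C₅ n₀ N τ Y F T)
    (hN : n₀ < N) {t₂ : ℝ} (ht₂ : t₂ ≤ T) (ht₂3 : t₂ ≤ 3) {t : ℝ} (ht : t ∈ Icc 0 t₂) :
    |Y 2 (-1) t| ≤ Real.exp (7 * 10 ^ 5 * K ^ 10) * ε ^ 2 := by
  have hε := hs.ε_pos
  have hK := hs.K_pos
  have hbbar : (0 : ℝ) ≤ 2 * 10 ^ 5 * ε := by positivity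
  have hE1 : (0 : ℝ) ≤ 2 * (K ^ 10)⁻¹ := by positivity
  have h := hs.hyp.coarse_c_abs_le hε hs.C₁_nn hs.ε₀_pos hs.τ₀_le hE1 hbbar
    (hs.F_negOne_le_on ht₂) (fun s hs' => hs.coarse_b_le hN ht₂ ht₂3 hs') ht
  -- the initial value
  have hc0 : |Y 2 (-1) 0| ≤ Real.exp (K ^ 10) * ε ^ 2 := by
    have h1 := hs.hyp.c_prev_le hN
    have h2 := hs.hyp.c_prev_ge hN
    have h3 : 0 ≤ Real.exp (K ^ 9) * ε ^ 2 := by positivity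
    rw [abs_of_nonneg (h3.trans h2)]; exact h1
  -- the source integral
  have hQ := hs.Q_le_one
  have hQ0 := hs.Q_pos
  have hη : C₁ * (1 + ε₀) ^ (-2 - (n₀ : ℝ) / 2) * Real.sqrt (2 * (K ^ 10)⁻¹) ≤ ε ^ 2 * (K ^ 100)⁻¹ :=
    hs.eta_le.trans hs.late_le_ε_sq
  have hK10 : (K ^ 10)⁻¹ ≤ 1 / 2 := hs.inv_K_pow_le_half (by norm_num)
  have hK100 : (K ^ 100)⁻¹ ≤ 1 / 2 := hs.inv_K_pow_le_half (by norm_num)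
  have hexp1 : Real.exp (-K ^ 10) ≤ 1 := by
    rw [Real.exp_le_one_iff]; have := pow_nonneg hK.le 10; linarith
  have hα : (1 + ε₀) ^ (-((5 : ℝ) / 2)) * (2 * ε ^ 2 * Real.exp (-K ^ 10) * (2 * (K ^ 10)⁻¹)) +
      C₁ * (1 + ε₀) ^ (-2 - (n₀ : ℝ) / 2) * Real.sqrt (2 * (K ^ 10)⁻¹) ≤ 3 * ε ^ 2 := by
    have : (1 + ε₀) ^ (-((5 : ℝ) / 2)) * (2 * ε ^ 2 * Real.exp (-K ^ 10) * (2 * (K ^ 10)⁻¹)) ≤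
        1 * (2 * ε ^ 2 * 1 * (2 * (1 / 2))) := by gcongr
    nlinarith [sq_nonneg ε]
  have hint : ∫ s in (0 : ℝ)..t,
      (fun _ : ℝ => (1 + ε₀) ^ (-((5 : ℝ) / 2)) * (2 * ε ^ 2 * Real.exp (-K ^ 10) * (2 * (K ^ 10)⁻¹)) +
        C₁ * (1 + ε₀) ^ (-2 - (n₀ : ℝ) / 2) * Real.sqrt (2 * (K ^ 10)⁻¹)) s ≤ 3 * ε ^ 2 * 3 := by
    rw [intervalIntegral.integral_const, smul_eq_mul]
    have ht3 : t - 0 ≤ 3 := by linarith [ht.2.trans ht₂3]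
    have ht0 : 0 ≤ t - 0 := by linarith [ht.1]
    have hη0 := hs.eta_nonneg
    calc (t - 0) * _ ≤ 3 * (3 * ε ^ 2) :=
          mul_le_mul ht3 hα (add_nonneg (by positivity) hη0) (by norm_num)
      _ = _ := by ring
  -- the exponent
  have hexp : Real.exp ((1 + ε₀) ^ (-((5 : ℝ) / 2)) * (ε⁻¹ * K ^ 10) * (2 * 10 ^ 5 * ε) * (t - 0)) ≤
      Real.exp (6 * 10 ^ 5 * K ^ 10) := by
    apply Real.exp_le_exp.2
    have ht3 : t - 0 ≤ 3 := by linarith [ht.2.trans ht₂3]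
    have ht0 : 0 ≤ t - 0 := by linarith [ht.1]
    have e1 : (1 + ε₀) ^ (-((5 : ℝ) / 2)) * (ε⁻¹ * K ^ 10) * (2 * 10 ^ 5 * ε) =
        (1 + ε₀) ^ (-((5 : ℝ) / 2)) * (2 * 10 ^ 5 * K ^ 10) := by field_simp
    rw [e1]
    have hK10' : 0 ≤ K ^ 10 := pow_nonneg hK.le 10
    calc (1 + ε₀) ^ (-((5 : ℝ) / 2)) * (2 * 10 ^ 5 * K ^ 10) * (t - 0)
        ≤ 1 * (2 * 10 ^ 5 * K ^ 10) * 3 := by gcongr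
      _ = 6 * 10 ^ 5 * K ^ 10 := by ring
  have hsum : |Y 2 (-1) 0| + ∫ s in (0 : ℝ)..t,
      (fun _ : ℝ => (1 + ε₀) ^ (-((5 : ℝ) / 2)) * (2 * ε ^ 2 * Real.exp (-K ^ 10) * (2 * (K ^ 10)⁻¹)) +
        C₁ * (1 + ε₀) ^ (-2 - (n₀ : ℝ) / 2) * Real.sqrt (2 * (K ^ 10)⁻¹)) s ≤
      (Real.exp (K ^ 10) + 9) * ε ^ 2 := by linarith
  have h9 : Real.exp (K ^ 10) + 9 ≤ Real.exp (10 ^ 5 * K ^ 10) := by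
    have hK6 := hs.K_large
    have hK10 : (1 : ℝ) ≤ K ^ 10 := one_le_pow₀ hs.one_le_K
    have h1 : Real.exp (K ^ 10) ≤ Real.exp (10 ^ 5 * K ^ 10 - 3) := Real.exp_le_exp.2 (by nlinarith)
    have h2 : (9 : ℝ) ≤ Real.exp (10 ^ 5 * K ^ 10 - 3) := by
      have : (3 : ℝ) ≤ 10 ^ 5 * K ^ 10 - 3 := by nlinarith
      have h4 := Real.add_one_le_exp (10 ^ 5 * K ^ 10 - 3)
      have h5 : Real.exp 1 ≤ Real.exp (10 ^ 5 * K ^ 10 - 3 - 1) := Real.exp_le_exp.2 (by linarith)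
      have h6 : (2 : ℝ) ≤ Real.exp 1 := by
        have := Real.add_one_le_exp (1 : ℝ); linarith
      have h7 : Real.exp (10 ^ 5 * K ^ 10 - 3) = Real.exp (10 ^ 5 * K ^ 10 - 3 - 1) * Real.exp 1 := by
        rw [← Real.exp_add]; congr 1; ring
      nlinarith [Real.exp_pos (10 ^ 5 * K ^ 10 - 3 - 1)]
    have h3 : Real.exp (10 ^ 5 * K ^ 10 - 3) * 2 ≤ Real.exp (10 ^ 5 * K ^ 10) := by
      have : Real.exp (10 ^ 5 * K ^ 10) = Real.exp (10 ^ 5 * K ^ 10 - 3) * Real.exp 3 := by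
        rw [← Real.exp_add]; congr 1; ring
      rw [this]
      gcongr
      have := Real.add_one_le_exp (3 : ℝ); linarith
    linarith
  have hpos : 0 ≤ |Y 2 (-1) 0| + ∫ s in (0 : ℝ)..t,
      (fun _ : ℝ => (1 + ε₀) ^ (-((5 : ℝ) / 2)) * (2 * ε ^ 2 * Real.exp (-K ^ 10) * (2 * (K ^ 10)⁻¹)) +
        C₁ * (1 + ε₀) ^ (-2 - (n₀ : ℝ) / 2) * Real.sqrt (2 * (K ^ 10)⁻¹)) s := by
    have hη0 := hs.eta_nonneg
    have : 0 ≤ ∫ s in (0 : ℝ)..t,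
        (fun _ : ℝ => (1 + ε₀) ^ (-((5 : ℝ) / 2)) * (2 * ε ^ 2 * Real.exp (-K ^ 10) * (2 * (K ^ 10)⁻¹)) +
          C₁ * (1 + ε₀) ^ (-2 - (n₀ : ℝ) / 2) * Real.sqrt (2 * (K ^ 10)⁻¹)) s :=
      intervalIntegral.integral_nonneg ht.1 fun s _ => add_nonneg (by positivity) hη0
    positivity
  calc |Y 2 (-1) t| ≤ _ := h
    _ ≤ Real.exp (6 * 10 ^ 5 * K ^ 10) * ((Real.exp (K ^ 10) + 9) * ε ^ 2) :=
        mul_le_mul hexp hsum hpos (Real.exp_pos _).le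
    _ ≤ Real.exp (6 * 10 ^ 5 * K ^ 10) * (Real.exp (10 ^ 5 * K ^ 10) * ε ^ 2) := by gcongr
    _ = Real.exp (7 * 10 ^ 5 * K ^ 10) * ε ^ 2 := by
        rw [← mul_assoc, ← Real.exp_add]; congr 1; congr 1; ring


/-- **(6.170) in the regime**: for `N > n₀`, `b₋₁ ≥ 10⁻⁶ ε` on `[0, t₂]`, `t₂ ≤ min T 3` ("Inserting
(6.169) back into (6.135), `∂ₜb₋₁ ≥ -O(exp(O(K¹⁰)))ε³` and hence by (6.60) `b₋₁(t) ≥ 10⁻⁶ε` … if `ε`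
is small enough"; here `ε ≤ exp(-10⁶K¹⁰)`). [cite: Tao2016AveragedNS, §6.7 (6.170)] -/
theorem Setting.coarse_b_ge (hs : Setting ε₀ K ε C₁ C₂ C₃ C₄ C₅ n₀ N τ Y F T) (hN : n₀ < N)
    {t₂ : ℝ} (ht₂ : t₂ ≤ T) (ht₂3 : t₂ ≤ 3) {t : ℝ} (ht : t ∈ Icc 0 t₂) :
    1 / 10 ^ 6 * ε ≤ Y 1 (-1) t := by
  have hε := hs.ε_pos
  have hK := hs.K_pos
  have h := hs.hyp.coarse_b_lower hε hs.C₁_nn hs.ε₀_pos hs.τ₀_le (hs.F_negOne_le_on ht₂)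
    (fun s hs' => hs.coarse_c_abs_le_regime hN ht₂ ht₂3 hs') ht
  have hb0 := hs.hyp.b_prev_ge hN
  have hQ := hs.Q_le_one
  have hQ0 := hs.Q_pos
  have hη : C₁ * (1 + ε₀) ^ (-2 - (n₀ : ℝ) / 2) * Real.sqrt (2 * (K ^ 10)⁻¹) ≤ ε ^ 2 * (K ^ 100)⁻¹ :=
    hs.eta_le.trans hs.late_le_ε_sq
  -- the key smallness: `ε⁻¹ K¹⁰ (exp(7·10⁵K¹⁰) ε²)² ≤ ε K⁻³⁰`
  have hsmall : ε⁻¹ * K ^ 10 * (Real.exp (7 * 10 ^ 5 * K ^ 10) * ε ^ 2) ^ 2 ≤ ε * (K ^ 30)⁻¹ := by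
    have e1 : ε⁻¹ * K ^ 10 * (Real.exp (7 * 10 ^ 5 * K ^ 10) * ε ^ 2) ^ 2 =
        ε * K ^ 10 * (ε ^ 2 * Real.exp (14 * 10 ^ 5 * K ^ 10)) := by
      have : (Real.exp (7 * 10 ^ 5 * K ^ 10)) ^ 2 = Real.exp (14 * 10 ^ 5 * K ^ 10) := by
        rw [← Real.exp_nat_mul]; congr 1; push_cast; ring
      rw [mul_pow, this]
      have e2 : ε⁻¹ * K ^ 10 * (Real.exp (14 * 10 ^ 5 * K ^ 10) * (ε ^ 2) ^ 2) =
          (ε⁻¹ * ε) * (ε * K ^ 10 * (ε ^ 2 * Real.exp (14 * 10 ^ 5 * K ^ 10))) := by ring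
      rw [e2, inv_mul_cancel₀ hε.ne', one_mul]
    rw [e1]
    have h2 := hs.ε_sq_mul_exp_le hε (14 * 10 ^ 5)
    have h3 : Real.exp (-(2 * 10 ^ 6 - 14 * 10 ^ 5) * K ^ 10) ≤ (K ^ 40)⁻¹ := by
      have : -(2 * 10 ^ 6 - 14 * 10 ^ 5) * K ^ 10 = -((6 * 10 ^ 5) * K ^ 10) := by ring
      rw [this]; exact hs.exp_neg_mul_K10_le (by norm_num)
    calc ε * K ^ 10 * (ε ^ 2 * Real.exp (14 * 10 ^ 5 * K ^ 10)) ≤ ε * K ^ 10 * (K ^ 40)⁻¹ := by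
          gcongr; exact h2.trans h3
      _ = ε * ((K ^ 40)⁻¹ * K ^ 10) := by ring
      _ ≤ ε * (K ^ 30)⁻¹ := by gcongr; exact hs.inv_K40_mul_le le_rfl
  have hK30 : (K ^ 30)⁻¹ ≤ 1 / 2 := hs.inv_K_pow_le_half (by norm_num)
  have hK100 : (K ^ 100)⁻¹ ≤ 1 / 2 := hs.inv_K_pow_le_half (by norm_num)
  have hεK := hs.ε_le_K100
  have hrate : (1 + ε₀) ^ (-((5 : ℝ) / 2)) * (ε⁻¹ * K ^ 10) *
      (Real.exp (7 * 10 ^ 5 * K ^ 10) * ε ^ 2) ^ 2 +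
        C₁ * (1 + ε₀) ^ (-2 - (n₀ : ℝ) / 2) * Real.sqrt (2 * (K ^ 10)⁻¹) ≤ 3 / 10 ^ 6 * ε := by
    have e1 : (1 + ε₀) ^ (-((5 : ℝ) / 2)) * (ε⁻¹ * K ^ 10) * (Real.exp (7 * 10 ^ 5 * K ^ 10) * ε ^ 2) ^ 2
        ≤ 1 * (ε * (K ^ 30)⁻¹) := by
      rw [mul_assoc]
      exact mul_le_mul hQ hsmall (by positivity) (by norm_num)
    have e2 : ε ^ 2 * (K ^ 100)⁻¹ ≤ ε * (K ^ 100)⁻¹ := by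
      have hε1 := hs.ε_le_one hε
      have : ε ^ 2 ≤ ε := by nlinarith
      gcongr
    have e3 : (K ^ 30)⁻¹ ≤ 1 / 10 ^ 6 := by
      have h1 := hs.inv_pow_succ_le 29
      have h2 : (K ^ 29)⁻¹ ≤ 1 := by
        have := hs.inv_pow_anti (n := 0) (m := 29) (by norm_num); simpa using this
      calc (K ^ 30)⁻¹ = (K ^ (29 + 1))⁻¹ := by norm_num
        _ ≤ 1 / 10 ^ 6 * (K ^ 29)⁻¹ := h1
        _ ≤ 1 / 10 ^ 6 * 1 := by gcongr
        _ = 1 / 10 ^ 6 := by ring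
    have e4 : (K ^ 100)⁻¹ ≤ 1 / 10 ^ 6 := (hs.inv_pow_anti (by norm_num)).trans e3
    nlinarith [mul_le_mul_of_nonneg_left e3 hε.le, mul_le_mul_of_nonneg_left e4 hε.le]
  have ht0 := ht.1
  have ht3 : t ≤ 3 := ht.2.trans ht₂3
  have hloss : ((1 + ε₀) ^ (-((5 : ℝ) / 2)) * (ε⁻¹ * K ^ 10) *
      (Real.exp (7 * 10 ^ 5 * K ^ 10) * ε ^ 2) ^ 2 +
        C₁ * (1 + ε₀) ^ (-2 - (n₀ : ℝ) / 2) * Real.sqrt (2 * (K ^ 10)⁻¹)) * t ≤ 3 / 10 ^ 6 * ε * 3 := by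
    apply mul_le_mul hrate ht3 ht0 (by positivity)
  linarith

/-- `|b₋₁| ≤ 2·10⁵ ε` on `[0, t₂]` ((6.172) "`b₋₁ = O(ε)`"). [cite: Tao2016AveragedNS, §6.7 (6.172)] -/
theorem Setting.coarse_b_abs_le (hs : Setting ε₀ K ε C₁ C₂ C₃ C₄ C₅ n₀ N τ Y F T) (hN : n₀ < N)
    {t₂ : ℝ} (ht₂ : t₂ ≤ T) (ht₂3 : t₂ ≤ 3) {t : ℝ} (ht : t ∈ Icc 0 t₂) :
    |Y 1 (-1) t| ≤ 2 * 10 ^ 5 * ε := by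
  have h1 := hs.coarse_b_le hN ht₂ ht₂3 ht
  have h2 := hs.coarse_b_ge hN ht₂ ht₂3 ht
  have hε := hs.ε_pos
  rw [abs_le]; constructor <;> nlinarith

/-- **(6.171) in the regime**: for `N > n₀`, `c₋₁(t) ≥ exp(10⁻⁶K¹⁰t/8) ε²` on `[0, t₂]`, `t₂ ≤ min T 3`
(exponential growth with the rate `(1+ε₀)^{-5/2}ε⁻¹K¹⁰·10⁻⁶ε ≥ 10⁻⁶K¹⁰/8` from (6.62)
`c₋₁(0) ≥ exp(K⁹)ε²`). [cite: Tao2016AveragedNS, §6.7 (6.171)] -/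
theorem Setting.coarse_c_ge_exp (hs : Setting ε₀ K ε C₁ C₂ C₃ C₄ C₅ n₀ N τ Y F T) (hN : n₀ < N)
    {t₂ : ℝ} (ht₂ : t₂ ≤ T) (ht₂3 : t₂ ≤ 3) {t : ℝ} (ht : t ∈ Icc 0 t₂) :
    Real.exp (1 / (8 * 10 ^ 6) * K ^ 10 * t) * (Real.exp (K ^ 9) / 2 * ε ^ 2) ≤ Y 2 (-1) t := by
  have hε := hs.ε_pos
  have hK := hs.K_pos
  have hblo : (0 : ℝ) ≤ 1 / 10 ^ 6 * ε := by positivity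
  have hη : C₁ * (1 + ε₀) ^ (-2 - (n₀ : ℝ) / 2) * Real.sqrt (2 * (K ^ 10)⁻¹) ≤ ε ^ 2 * (K ^ 100)⁻¹ :=
    hs.eta_le.trans hs.late_le_ε_sq
  have hη0 := hs.eta_nonneg
  have hK100 : (K ^ 100)⁻¹ ≤ 1 / 10 ^ 6 := hs.inv_K_pow_le_inv_ten6 (by norm_num)
  have hc0 := hs.hyp.c_prev_ge hN
  have ht0 := ht.1
  have ht3 : t ≤ 3 := ht.2.trans ht₂3
  have hK9 : (2 : ℝ) ≤ Real.exp (K ^ 9) := by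
    have h1 := Real.add_one_le_exp (K ^ 9)
    have h2 : (1 : ℝ) ≤ K ^ 9 := one_le_pow₀ hs.one_le_K
    linarith
  -- `η t ≤ 3·10⁻⁶ ε² ≤ c₋₁(0)/2`
  have hηt : C₁ * (1 + ε₀) ^ (-2 - (n₀ : ℝ) / 2) * Real.sqrt (2 * (K ^ 10)⁻¹) * (t - 0) ≤
      ε ^ 2 * (3 / 10 ^ 6) := by
    calc _ ≤ ε ^ 2 * (K ^ 100)⁻¹ * 3 := by
          apply mul_le_mul hη (by linarith) (by linarith) (by positivity)
      _ ≤ ε ^ 2 * (1 / 10 ^ 6) * 3 := by gcongr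
      _ = _ := by ring
  have hinit : C₁ * (1 + ε₀) ^ (-2 - (n₀ : ℝ) / 2) * Real.sqrt (2 * (K ^ 10)⁻¹) * (t - 0) ≤
      Y 2 (-1) 0 := by
    have : ε ^ 2 * (3 / 10 ^ 6) ≤ Real.exp (K ^ 9) * ε ^ 2 := by nlinarith [sq_nonneg ε]
    linarith
  have h := hs.hyp.coarse_c_lower hε hs.C₁_nn hs.ε₀_pos hs.τ₀_le hblo (hs.F_negOne_le_on ht₂)
    (fun s hs' => hs.coarse_b_ge hN ht₂ ht₂3 hs') ht hinit
  -- compare the rates and the initial factors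
  have hQ := hs.Q_ge
  have hrate : 1 / (8 * 10 ^ 6) * K ^ 10 * t ≤
      (1 + ε₀) ^ (-((5 : ℝ) / 2)) * (ε⁻¹ * K ^ 10) * (1 / 10 ^ 6 * ε) * (t - 0) := by
    have e1 : (1 + ε₀) ^ (-((5 : ℝ) / 2)) * (ε⁻¹ * K ^ 10) * (1 / 10 ^ 6 * ε) * (t - 0) =
        (1 + ε₀) ^ (-((5 : ℝ) / 2)) * (1 / 10 ^ 6) * (K ^ 10 * t) := by
      rw [sub_zero]; field_simp
    rw [e1]
    have hKt : 0 ≤ K ^ 10 * t := by positivity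
    calc 1 / (8 * 10 ^ 6) * K ^ 10 * t = 1 / 8 * (1 / 10 ^ 6) * (K ^ 10 * t) := by ring
      _ ≤ (1 + ε₀) ^ (-((5 : ℝ) / 2)) * (1 / 10 ^ 6) * (K ^ 10 * t) := by gcongr
  have hfac : Real.exp (K ^ 9) / 2 * ε ^ 2 ≤
      Y 2 (-1) 0 - C₁ * (1 + ε₀) ^ (-2 - (n₀ : ℝ) / 2) * Real.sqrt (2 * (K ^ 10)⁻¹) * (t - 0) := by
    nlinarith [sq_nonneg ε]
  calc Real.exp (1 / (8 * 10 ^ 6) * K ^ 10 * t) * (Real.exp (K ^ 9) / 2 * ε ^ 2)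
      ≤ Real.exp ((1 + ε₀) ^ (-((5 : ℝ) / 2)) * (ε⁻¹ * K ^ 10) * (1 / 10 ^ 6 * ε) * (t - 0)) *
          (Y 2 (-1) 0 - C₁ * (1 + ε₀) ^ (-2 - (n₀ : ℝ) / 2) * Real.sqrt (2 * (K ^ 10)⁻¹) * (t - 0)) := by
        gcongr
    _ ≤ Y 2 (-1) t := h

/-- `exp 1 ≤ 3 ≤ exp(K⁹)/2`-type facts: `2 ≤ exp(K⁹)`. [folklore] -/
theorem Setting.two_le_exp_K9 (hs : Setting ε₀ K ε C₁ C₂ C₃ C₄ C₅ n₀ N τ Y F T) :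
    (2 : ℝ) ≤ Real.exp (K ^ 9) := by
  have h1 := Real.add_one_le_exp (K ^ 9)
  have h2 : (1 : ℝ) ≤ K ^ 9 := one_le_pow₀ hs.one_le_K
  linarith

/-- `c₋₁ ≥ exp(K⁹) ε²/2` on `[0, t₂]` (from (6.62) and the growth (6.171)). [cite: Tao2016AveragedNS, §6.7 (6.171)] -/
theorem Setting.coarse_c_ge_expK9 (hs : Setting ε₀ K ε C₁ C₂ C₃ C₄ C₅ n₀ N τ Y F T) (hN : n₀ < N)
    {t₂ : ℝ} (ht₂ : t₂ ≤ T) (ht₂3 : t₂ ≤ 3) {t : ℝ} (ht : t ∈ Icc 0 t₂) :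
    Real.exp (K ^ 9) / 2 * ε ^ 2 ≤ Y 2 (-1) t := by
  have h := hs.coarse_c_ge_exp hN ht₂ ht₂3 ht
  have h1 : 1 ≤ Real.exp (1 / (8 * 10 ^ 6) * K ^ 10 * t) := by
    apply Real.one_le_exp
    have := pow_nonneg hs.K_pos.le 10
    have := ht.1
    positivity
  have h0 : 0 ≤ Real.exp (K ^ 9) / 2 * ε ^ 2 := by positivity
  nlinarith

/-- `c₋₁ ≥ ε²` (in particular `c₋₁ > 0`) on `[0, t₂]`. [cite: Tao2016AveragedNS, §6.7 (6.171)] -/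
theorem Setting.coarse_c_ge_sq (hs : Setting ε₀ K ε C₁ C₂ C₃ C₄ C₅ n₀ N τ Y F T) (hN : n₀ < N)
    {t₂ : ℝ} (ht₂ : t₂ ≤ T) (ht₂3 : t₂ ≤ 3) {t : ℝ} (ht : t ∈ Icc 0 t₂) : ε ^ 2 ≤ Y 2 (-1) t := by
  have h := hs.coarse_c_ge_expK9 hN ht₂ ht₂3 ht
  have h2 := hs.two_le_exp_K9
  nlinarith [sq_nonneg ε]

/-- On `[1/2, t₂]`: `c₋₁ ≥ exp(6·10⁻⁸ K¹⁰) ε²` (the source's (6.171) "`c₋₁(t) ≥ exp(10⁻⁸K¹⁰)ε²` for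
`1/10 ≤ t ≤ τ₁`", at the times `t ≥ t_c ≥ 1/2` where it is used). [cite: Tao2016AveragedNS, §6.7 (6.171)] -/
theorem Setting.coarse_c_ge_late (hs : Setting ε₀ K ε C₁ C₂ C₃ C₄ C₅ n₀ N τ Y F T) (hN : n₀ < N)
    {t₂ : ℝ} (ht₂ : t₂ ≤ T) (ht₂3 : t₂ ≤ 3) {t : ℝ} (ht : t ∈ Icc 0 t₂) (ht2 : 1 / 2 ≤ t) :
    Real.exp (6 / 10 ^ 8 * K ^ 10) * ε ^ 2 ≤ Y 2 (-1) t := by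
  have h := hs.coarse_c_ge_exp hN ht₂ ht₂3 ht
  have h2 := hs.two_le_exp_K9
  have h3 : ε ^ 2 ≤ Real.exp (K ^ 9) / 2 * ε ^ 2 := by nlinarith [sq_nonneg ε]
  have h4 : Real.exp (6 / 10 ^ 8 * K ^ 10) ≤ Real.exp (1 / (8 * 10 ^ 6) * K ^ 10 * t) := by
    apply Real.exp_le_exp.2
    have hK10 := pow_nonneg hs.K_pos.le 10
    have h1 : 1 / (8 * 10 ^ 6) * K ^ 10 * (1 / 2) ≤ 1 / (8 * 10 ^ 6) * K ^ 10 * t :=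
      mul_le_mul_of_nonneg_left ht2 (by positivity)
    nlinarith
  calc Real.exp (6 / 10 ^ 8 * K ^ 10) * ε ^ 2
      ≤ Real.exp (1 / (8 * 10 ^ 6) * K ^ 10 * t) * (Real.exp (K ^ 9) / 2 * ε ^ 2) :=
        mul_le_mul h4 h3 (sq_nonneg ε) (Real.exp_pos _).le
    _ ≤ _ := h

/-- **(6.173) in the regime**: for `N > n₀`, `|∂ₜc₋₁| ≤ (2·10⁵K¹⁰ + 1) c₋₁` on `[0, t₂]`, `t₂ ≤ min T 3`.
[cite: Tao2016AveragedNS, §6.7 (6.173)] -/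
theorem Setting.coarse_dc_le (hs : Setting ε₀ K ε C₁ C₂ C₃ C₄ C₅ n₀ N τ Y F T) (hN : n₀ < N)
    {t₂ : ℝ} (ht₂ : t₂ ≤ T) (ht₂3 : t₂ ≤ 3) {t : ℝ} (ht : t ∈ Icc 0 t₂) :
    |dY (τ (n₀ - N)) Y 2 (-1) t| ≤ (2 * 10 ^ 5 * K ^ 10 + 1) * Y 2 (-1) t := by
  have hε := hs.ε_pos
  have hK := hs.K_pos
  have htT : t ∈ Icc 0 T := ⟨ht.1, ht.2.trans ht₂⟩
  have h := hs.hyp.coarse_c_deriv_abs_le hε hs.C₁_nn hs.ε₀_pos (hs.τ₀_le.trans ht.1)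
    (hs.F_negOne_le htT)
  have hb := hs.coarse_b_abs_le hN ht₂ ht₂3 ht
  have hc := hs.coarse_c_ge_sq hN ht₂ ht₂3 ht
  have hcpos : 0 < Y 2 (-1) t := lt_of_lt_of_le (by positivity) hc
  have hQ := hs.Q_le_one
  have hQ0 := hs.Q_pos
  have hη : C₁ * (1 + ε₀) ^ (-2 - (n₀ : ℝ) / 2) * Real.sqrt (2 * (K ^ 10)⁻¹) ≤ ε ^ 2 * (K ^ 100)⁻¹ :=
    hs.eta_le.trans hs.late_le_ε_sq
  have hK10 : (K ^ 10)⁻¹ ≤ 1 / 2 := hs.inv_K_pow_le_half (by norm_num)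
  have hK100 : (K ^ 100)⁻¹ ≤ 1 / 2 := hs.inv_K_pow_le_half (by norm_num)
  have hexp1 : Real.exp (-K ^ 10) ≤ 1 := by
    rw [Real.exp_le_one_iff]; have := pow_nonneg hK.le 10; linarith
  rw [abs_of_pos hcpos] at h
  -- the rotation term
  have hrot : (1 + ε₀) ^ (-((5 : ℝ) / 2)) * (ε⁻¹ * K ^ 10 * (|Y 1 (-1) t| * Y 2 (-1) t)) ≤
      2 * 10 ^ 5 * K ^ 10 * Y 2 (-1) t := by
    calc (1 + ε₀) ^ (-((5 : ℝ) / 2)) * (ε⁻¹ * K ^ 10 * (|Y 1 (-1) t| * Y 2 (-1) t))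
        ≤ 1 * (ε⁻¹ * K ^ 10 * (2 * 10 ^ 5 * ε * Y 2 (-1) t)) := by gcongr
      _ = 2 * 10 ^ 5 * K ^ 10 * Y 2 (-1) t := by field_simp
  -- the small terms
  have hsmall : (1 + ε₀) ^ (-((5 : ℝ) / 2)) * (2 * ε ^ 2 * Real.exp (-K ^ 10) * (2 * (K ^ 10)⁻¹)) +
      C₁ * (1 + ε₀) ^ (-2 - (n₀ : ℝ) / 2) * Real.sqrt (2 * (K ^ 10)⁻¹) ≤ Y 2 (-1) t := by
    have e1 : (1 + ε₀) ^ (-((5 : ℝ) / 2)) * (2 * ε ^ 2 * Real.exp (-K ^ 10) * (2 * (K ^ 10)⁻¹)) ≤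
        1 * (2 * ε ^ 2 * 1 * (2 * (1 / 2 / 2 / 2))) := by
      gcongr
      calc (K ^ 10)⁻¹ ≤ 1 / 10 ^ 6 * (K ^ 9)⁻¹ := hs.inv_pow_succ_le 9
        _ ≤ 1 / 10 ^ 6 * 1 := by
            gcongr
            have := hs.inv_pow_anti (n := 0) (m := 9) (by norm_num); simpa using this
        _ ≤ 1 / 2 / 2 / 2 := by norm_num
    nlinarith [sq_nonneg ε]
  have hsplit : (1 + ε₀) ^ (-((5 : ℝ) / 2)) *
      (2 * ε ^ 2 * Real.exp (-K ^ 10) * (2 * (K ^ 10)⁻¹) + ε⁻¹ * K ^ 10 * (|Y 1 (-1) t| * Y 2 (-1) t)) =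
      (1 + ε₀) ^ (-((5 : ℝ) / 2)) * (2 * ε ^ 2 * Real.exp (-K ^ 10) * (2 * (K ^ 10)⁻¹)) +
        (1 + ε₀) ^ (-((5 : ℝ) / 2)) * (ε⁻¹ * K ^ 10 * (|Y 1 (-1) t| * Y 2 (-1) t)) := by ring
  rw [hsplit] at h
  show |derivWithin (Y 2 (-1)) (Ici (τ (n₀ - N))) t| ≤ _
  nlinarith

end Secondary

/-! ## The modified energy `E*` and its derivative -/

/-- The coefficient `ρ := (1+ε₀)^{-5/2} ε⁻²` of the coarse rotor `ρ c₋₁` in (6.134)/(6.137).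
[cite: Tao2016AveragedNS, §6.6 (6.134)] -/
def coarseRho (ε₀ ε : ℝ) : ℝ :=
  (1 + ε₀) ^ (-((5 : ℝ) / 2)) * (ε ^ 2)⁻¹

/-- The correction `a₋₁ d₋₁ a₀ / (ρ c₋₁) = (1+ε₀)^{5/2} a₋₁ d₋₁ (ε²/c₋₁) a₀` of the modified energy
`E*` of the proof of Prop. 6.17. [cite: Tao2016AveragedNS, §6.7 proof of Prop. 6.17] -/
def coarseCorr (ε₀ ε : ℝ) (Y : Fin 4 → ℤ → ℝ → ℝ) (t : ℝ) : ℝ :=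
  Y 0 (-1) t * Y 3 (-1) t * Y 0 0 t / (coarseRho ε₀ ε * Y 2 (-1) t)

/-- **The modified energy** `E* := Ẽ₋₁ - ½ (1+ε₀)^{5/2} K a₋₁ d₋₁ (ε²/c₋₁) a₀` of the proof of
Prop. 6.17. [cite: Tao2016AveragedNS, §6.7 proof of Prop. 6.17] -/
def coarseEnergy (ε₀ K ε : ℝ) (Y : Fin 4 → ℤ → ℝ → ℝ) (F : ℤ → ℝ → ℝ) (t : ℝ) : ℝ :=
  F (-1) t - 1 / 2 * K * coarseCorr ε₀ ε Y t

/-- The one-sided derivative of the correction (product/quotient rule, cf.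
`correction_hasDerivWithinAt`). [cite: Tao2016AveragedNS, §6.7 proof of Prop. 6.17] -/
def coarseCorrDeriv (ε₀ ε τ₀ : ℝ) (Y : Fin 4 → ℤ → ℝ → ℝ) (t : ℝ) : ℝ :=
  (((dY τ₀ Y 0 (-1) t * Y 3 (-1) t + Y 0 (-1) t * dY τ₀ Y 3 (-1) t) * Y 0 0 t +
        Y 0 (-1) t * Y 3 (-1) t * dY τ₀ Y 0 0 t) * (coarseRho ε₀ ε * Y 2 (-1) t) -
      Y 0 (-1) t * Y 3 (-1) t * Y 0 0 t * (coarseRho ε₀ ε * dY τ₀ Y 2 (-1) t)) /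
    (coarseRho ε₀ ε * Y 2 (-1) t) ^ 2

/-- The one-sided derivative of `E*`. [cite: Tao2016AveragedNS, §6.7 proof of Prop. 6.17] -/
def coarseEnergyDeriv (ε₀ K ε τ₀ : ℝ) (Y : Fin 4 → ℤ → ℝ → ℝ) (F : ℤ → ℝ → ℝ) (t : ℝ) : ℝ :=
  dF τ₀ F (-1) t - 1 / 2 * K * coarseCorrDeriv ε₀ ε τ₀ Y t

section ModifiedEnergy

variable {ε₀ K ε C₁ C₂ C₃ C₄ C₅ : ℝ} {n₀ N : ℤ} {τ : ℤ → ℝ} {Y : Fin 4 → ℤ → ℝ → ℝ}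
  {F : ℤ → ℝ → ℝ} {T : ℝ}

/-- `ρ > 0`. [folklore] -/
theorem Setting.coarseRho_pos (hs : Setting ε₀ K ε C₁ C₂ C₃ C₄ C₅ n₀ N τ Y F T) :
    0 < coarseRho ε₀ ε := by
  unfold coarseRho
  have := hs.ε_pos
  exact mul_pos hs.Q_pos (by positivity)

/-- `1/(ρ c₋₁) ≤ 8 ε²/c₋₁` hence `≤ 8ε²/m` whenever `c₋₁ ≥ m > 0`. [folklore] -/
theorem Setting.inv_rho_mul_le (hs : Setting ε₀ K ε C₁ C₂ C₃ C₄ C₅ n₀ N τ Y F T) {c m : ℝ}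
    (hm : 0 < m) (hmc : m ≤ c) : 1 / (coarseRho ε₀ ε * c) ≤ 8 * ε ^ 2 / m := by
  have hε := hs.ε_pos
  have hQ := hs.Q_ge
  have hQ0 := hs.Q_pos
  have hc : 0 < c := hm.trans_le hmc
  unfold coarseRho
  rw [div_le_div_iff₀ (by positivity) hm]
  calc 1 * m = m := one_mul m
    _ ≤ c := hmc
    _ = 8 * ε ^ 2 * (1 / 8 * (ε ^ 2)⁻¹ * c) := by field_simp
    _ ≤ 8 * ε ^ 2 * ((1 + ε₀) ^ (-((5 : ℝ) / 2)) * (ε ^ 2)⁻¹ * c) := by gcongr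

/-- `E*` has the one-sided derivative `coarseEnergyDeriv` on `[0, t₂]` (where `c₋₁ > 0`).
[cite: Tao2016AveragedNS, §6.7 proof of Prop. 6.17] -/
theorem Setting.hasDerivWithinAt_coarseEnergy (hs : Setting ε₀ K ε C₁ C₂ C₃ C₄ C₅ n₀ N τ Y F T)
    (hN : n₀ < N) {t₂ : ℝ} (ht₂ : t₂ ≤ T) (ht₂3 : t₂ ≤ 3) {t : ℝ} (ht : t ∈ Icc 0 t₂) :
    HasDerivWithinAt (coarseEnergy ε₀ K ε Y F) (coarseEnergyDeriv ε₀ K ε (τ (n₀ - N)) Y F t)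
      (Ici t) t := by
  have hε := hs.ε_pos
  have hc := hs.coarse_c_ge_sq hN ht₂ ht₂3 ht
  have hcpos : 0 < Y 2 (-1) t := lt_of_lt_of_le (by positivity) hc
  have hρc : coarseRho ε₀ ε * Y 2 (-1) t ≠ 0 := (mul_pos hs.coarseRho_pos hcpos).ne'
  have ht0 : τ (n₀ - N) ≤ t := hs.τ₀_le.trans ht.1
  have h1 := hs.hyp.hasDeriv_E (-1) ht0
  have h2 := correction_hasDerivWithinAt (hs.hyp.contDiffOn_Y 0 (-1)) (hs.hyp.contDiffOn_Y 3 (-1))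
    (hs.hyp.contDiffOn_Y 0 0) (hs.hyp.contDiffOn_Y 2 (-1)) ht0 hρc
  have h3 := h1.sub (h2.const_mul (1 / 2 * K))
  exact h3

/-- `E*` is continuous on `[0, t₂]`. [cite: Tao2016AveragedNS, §6.7 proof of Prop. 6.17] -/
theorem Setting.continuousOn_coarseEnergy (hs : Setting ε₀ K ε C₁ C₂ C₃ C₄ C₅ n₀ N τ Y F T)
    (hN : n₀ < N) {t₂ : ℝ} (ht₂ : t₂ ≤ T) (ht₂3 : t₂ ≤ 3) :
    ContinuousOn (coarseEnergy ε₀ K ε Y F) (Icc 0 t₂) := by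
  have hε := hs.ε_pos
  have hτ := hs.τ₀_le
  have hρc : ∀ t ∈ Icc 0 t₂, coarseRho ε₀ ε * Y 2 (-1) t ≠ 0 := by
    intro t ht
    have hc := hs.coarse_c_ge_sq hN ht₂ ht₂3 ht
    have hcpos : 0 < Y 2 (-1) t := lt_of_lt_of_le (by positivity) hc
    exact (mul_pos hs.coarseRho_pos hcpos).ne'
  have hF := hs.hyp.continuousOn_E (-1) (b := t₂) hτ
  have ha := hs.hyp.continuousOn_X 0 (-1) (b := t₂) hτ
  have hd := hs.hyp.continuousOn_X 3 (-1) (b := t₂) hτ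
  have hb := hs.hyp.continuousOn_X 0 0 (b := t₂) hτ
  have hc := hs.hyp.continuousOn_X 2 (-1) (b := t₂) hτ
  have hcorr : ContinuousOn (coarseCorr ε₀ ε Y) (Icc 0 t₂) :=
    ((ha.mul hd).mul hb).div (continuousOn_const.mul hc) hρc
  exact hF.sub (continuousOn_const.mul hcorr)


/-! ### Numerical size of the constants in `∂ₜE*` -/

/-- `c K⁻⁽ⁿ⁺⁹⁾ ≤ K⁻ⁿ` for `c ≤ K⁹`. [folklore] -/
theorem Setting.const_mul_inv_pow_le (hs : Setting ε₀ K ε C₁ C₂ C₃ C₄ C₅ n₀ N τ Y F T) {c : ℝ}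
    (hc : c ≤ K ^ 9) (n : ℕ) : c * (K ^ (n + 9))⁻¹ ≤ (K ^ n)⁻¹ := by
  have hK := hs.K_pos
  rw [pow_add, mul_inv, ← mul_assoc, mul_comm c, mul_assoc]
  calc (K ^ n)⁻¹ * (c * (K ^ 9)⁻¹) ≤ (K ^ n)⁻¹ * 1 := by
        gcongr
        rw [mul_inv_le_iff₀ (pow_pos hK 9)]; linarith
    _ = (K ^ n)⁻¹ := mul_one _

/-- `10⁸ ≤ K⁹` (indeed `≤ K²`). [folklore] -/
theorem Setting.ten8_le_K9 (hs : Setting ε₀ K ε C₁ C₂ C₃ C₄ C₅ n₀ N τ Y F T) : (10 : ℝ) ^ 8 ≤ K ^ 9 := by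
  calc (10 : ℝ) ^ 8 ≤ (10 ^ 6) ^ 9 := by norm_num
    _ ≤ K ^ 9 := pow_le_pow_left₀ (by norm_num) hs.K_large 9

/-- `√(2 · 2K⁻¹⁰) = 2 K⁻⁵`. [folklore] -/
theorem Setting.sqrt_four_inv_K10 (hs : Setting ε₀ K ε C₁ C₂ C₃ C₄ C₅ n₀ N τ Y F T) :
    Real.sqrt (2 * (2 * (K ^ 10)⁻¹)) = 2 * (K ^ 5)⁻¹ := by
  have hK := hs.K_pos
  have h : 2 * (2 * (K ^ 10)⁻¹) = (2 * (K ^ 5)⁻¹) ^ 2 := by field_simp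
  rw [h, Real.sqrt_sq (by positivity)]

/-- The input term of (6.49) at scale `-1`: `θ₁ = 2K(1+ε₀)^{-5/2} E₂ √(2E₁) ≤ 8 K⁻¹⁴` for
`E₁ = E₂ = 2K⁻¹⁰` ((6.177)). [cite: Tao2016AveragedNS, §6.7 (6.177)] -/
theorem Setting.theta_le (hs : Setting ε₀ K ε C₁ C₂ C₃ C₄ C₅ n₀ N τ Y F T) :
    2 * K * (1 + ε₀) ^ (-((5 : ℝ) / 2)) * (2 * (K ^ 10)⁻¹) * Real.sqrt (2 * (2 * (K ^ 10)⁻¹)) ≤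
      8 * (K ^ 14)⁻¹ := by
  have hK := hs.K_pos
  have hQ := hs.Q_le_one
  have hQ0 := hs.Q_pos
  rw [hs.sqrt_four_inv_K10]
  calc 2 * K * (1 + ε₀) ^ (-((5 : ℝ) / 2)) * (2 * (K ^ 10)⁻¹) * (2 * (K ^ 5)⁻¹)
      ≤ 2 * K * 1 * (2 * (K ^ 10)⁻¹) * (2 * (K ^ 5)⁻¹) := by gcongr
    _ = 8 * (K ^ 14)⁻¹ := by field_simp; ring

/-- The error of the `a₋₁`-equation (6.134): `η₁ ≤ 5 K⁻⁹`. [cite: Tao2016AveragedNS, §6.6 (6.134)] -/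
theorem Setting.eta_one_le (hs : Setting ε₀ K ε C₁ C₂ C₃ C₄ C₅ n₀ N τ Y F T) :
    (1 + ε₀) ^ (-((5 : ℝ) / 2)) * (2 * ε * (2 * (K ^ 10)⁻¹) +
        2 * ε ^ 2 * Real.exp (-K ^ 10) * (2 * (K ^ 10)⁻¹) + 2 * K * (2 * (K ^ 10)⁻¹)) +
      C₁ * (1 + ε₀) ^ (-2 - (n₀ : ℝ) / 2) * Real.sqrt (2 * (K ^ 10)⁻¹) ≤ 5 * (K ^ 9)⁻¹ := by
  have hK := hs.K_pos
  have hε := hs.ε_pos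
  have hε1 := hs.ε_le_one hε
  have hQ := hs.Q_le_one
  have hQ0 := hs.Q_pos
  have hη : C₁ * (1 + ε₀) ^ (-2 - (n₀ : ℝ) / 2) * Real.sqrt (2 * (K ^ 10)⁻¹) ≤ ε ^ 2 * (K ^ 100)⁻¹ :=
    hs.eta_le.trans hs.late_le_ε_sq
  have hexp1 : Real.exp (-K ^ 10) ≤ 1 := by
    rw [Real.exp_le_one_iff]; have := pow_nonneg hK.le 10; linarith
  have hK10 : (K ^ 10)⁻¹ ≤ 1 / 10 ^ 6 * (K ^ 9)⁻¹ := hs.inv_pow_succ_le 9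
  have hK9 : 0 < (K ^ 9)⁻¹ := by positivity
  have e1 : 2 * K * (2 * (K ^ 10)⁻¹) = 4 * (K ^ 9)⁻¹ := by field_simp; ring
  have e2 : (1 + ε₀) ^ (-((5 : ℝ) / 2)) * (2 * ε * (2 * (K ^ 10)⁻¹) +
      2 * ε ^ 2 * Real.exp (-K ^ 10) * (2 * (K ^ 10)⁻¹) + 2 * K * (2 * (K ^ 10)⁻¹)) ≤
      1 * (2 * 1 * (2 * (1 / 10 ^ 6 * (K ^ 9)⁻¹)) + 2 * 1 ^ 2 * 1 * (2 * (1 / 10 ^ 6 * (K ^ 9)⁻¹)) +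
        4 * (K ^ 9)⁻¹) := by
    rw [e1]; gcongr
  have hK100' : (K ^ 100)⁻¹ ≤ (K ^ 10)⁻¹ := hs.inv_pow_anti (by norm_num)
  have e3 : ε ^ 2 * (K ^ 100)⁻¹ ≤ 1 * (1 / 10 ^ 6 * (K ^ 9)⁻¹) := by
    apply mul_le_mul _ (hK100'.trans hK10) (by positivity) (by norm_num)
    nlinarith
  linarith

/-- **The junk terms of `∂ₜE*` are `≤ K⁻³⁰`**: with `M₁ = 2K⁻⁵`, `M₀ = 3/2`, `L = 2·10⁵K¹⁰ + 1`,
`η₁ + η₂ ≤ 6K⁻⁹`, `w₁ ≤ 16K⁻⁴⁰`, `w₁ β₀ ≤ 32K⁻⁴⁰`: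
`½K w₁(K M₁²M₀² + (η₁+η₂)M₁M₀ + M₁²β₀ + M₁²M₀L) ≤ K⁻³⁰`. [cite: Tao2016AveragedNS, §6.7 proof of Prop. 6.17] -/
theorem Setting.junk_le (hs : Setting ε₀ K ε C₁ C₂ C₃ C₄ C₅ n₀ N τ Y F T) {w₁ β₀ S : ℝ}
    (hw1 : w₁ ≤ 16 * (K ^ 40)⁻¹) (hw2 : w₁ * β₀ ≤ 32 * (K ^ 40)⁻¹) (hS0 : 0 ≤ S)
    (hS : S ≤ 6 * (K ^ 9)⁻¹) :
    1 / 2 * K * w₁ * (K * (2 * (K ^ 5)⁻¹) ^ 2 * (3 / 2) ^ 2 + S * (2 * (K ^ 5)⁻¹) * (3 / 2) +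
        (2 * (K ^ 5)⁻¹) ^ 2 * β₀ + (2 * (K ^ 5)⁻¹) ^ 2 * (3 / 2) * (2 * 10 ^ 5 * K ^ 10 + 1)) ≤
      (K ^ 30)⁻¹ := by
  have hK := hs.K_pos
  have hK0 : K ≠ 0 := hK.ne'
  -- term by term
  have t1 : 1 / 2 * K * w₁ * (K * (2 * (K ^ 5)⁻¹) ^ 2 * (3 / 2) ^ 2) ≤ 72 * (K ^ 48)⁻¹ := by
    calc 1 / 2 * K * w₁ * (K * (2 * (K ^ 5)⁻¹) ^ 2 * (3 / 2) ^ 2)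
        ≤ 1 / 2 * K * (16 * (K ^ 40)⁻¹) * (K * (2 * (K ^ 5)⁻¹) ^ 2 * (3 / 2) ^ 2) := by gcongr
      _ = 72 * (K ^ 48)⁻¹ := by field_simp; ring
  have t2 : 1 / 2 * K * w₁ * (S * (2 * (K ^ 5)⁻¹) * (3 / 2)) ≤ 144 * (K ^ 53)⁻¹ := by
    calc 1 / 2 * K * w₁ * (S * (2 * (K ^ 5)⁻¹) * (3 / 2))
        ≤ 1 / 2 * K * (16 * (K ^ 40)⁻¹) * (6 * (K ^ 9)⁻¹ * (2 * (K ^ 5)⁻¹) * (3 / 2)) := by gcongr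
      _ = 144 * (K ^ 53)⁻¹ := by field_simp; ring
  have t3 : 1 / 2 * K * w₁ * ((2 * (K ^ 5)⁻¹) ^ 2 * β₀) ≤ 64 * (K ^ 49)⁻¹ := by
    have : 1 / 2 * K * w₁ * ((2 * (K ^ 5)⁻¹) ^ 2 * β₀) = 1 / 2 * K * (2 * (K ^ 5)⁻¹) ^ 2 * (w₁ * β₀) := by
      ring
    rw [this]
    calc 1 / 2 * K * (2 * (K ^ 5)⁻¹) ^ 2 * (w₁ * β₀) ≤ 1 / 2 * K * (2 * (K ^ 5)⁻¹) ^ 2 * (32 * (K ^ 40)⁻¹) := by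
          gcongr
      _ = 64 * (K ^ 49)⁻¹ := by field_simp; ring
  have t4 : 1 / 2 * K * w₁ * ((2 * (K ^ 5)⁻¹) ^ 2 * (3 / 2) * (2 * 10 ^ 5 * K ^ 10 + 1)) ≤
      48 * (K ^ 49)⁻¹ * (2 * 10 ^ 5 * K ^ 10 + 1) := by
    calc 1 / 2 * K * w₁ * ((2 * (K ^ 5)⁻¹) ^ 2 * (3 / 2) * (2 * 10 ^ 5 * K ^ 10 + 1))
        ≤ 1 / 2 * K * (16 * (K ^ 40)⁻¹) * ((2 * (K ^ 5)⁻¹) ^ 2 * (3 / 2) * (2 * 10 ^ 5 * K ^ 10 + 1)) := by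
          gcongr
      _ = 48 * (K ^ 49)⁻¹ * (2 * 10 ^ 5 * K ^ 10 + 1) := by field_simp; ring
  have t4' : 48 * (K ^ 49)⁻¹ * (2 * 10 ^ 5 * K ^ 10 + 1) = 96 * 10 ^ 5 * (K ^ 39)⁻¹ + 48 * (K ^ 49)⁻¹ := by
    field_simp; ring
  -- collect: everything is `≤ c K⁻³⁹` with `∑ c ≤ 10⁸ ≤ K⁹`
  have a1 : (K ^ 48)⁻¹ ≤ (K ^ 39)⁻¹ := hs.inv_pow_anti (by norm_num)
  have a2 : (K ^ 53)⁻¹ ≤ (K ^ 39)⁻¹ := hs.inv_pow_anti (by norm_num)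
  have a3 : (K ^ 49)⁻¹ ≤ (K ^ 39)⁻¹ := hs.inv_pow_anti (by norm_num)
  have hfin : 10 ^ 8 * (K ^ (30 + 9))⁻¹ ≤ (K ^ 30)⁻¹ := hs.const_mul_inv_pow_le hs.ten8_le_K9 30
  have h39 : 0 < (K ^ 39)⁻¹ := by positivity
  have hsplit : 1 / 2 * K * w₁ * (K * (2 * (K ^ 5)⁻¹) ^ 2 * (3 / 2) ^ 2 + S * (2 * (K ^ 5)⁻¹) * (3 / 2) +
        (2 * (K ^ 5)⁻¹) ^ 2 * β₀ + (2 * (K ^ 5)⁻¹) ^ 2 * (3 / 2) * (2 * 10 ^ 5 * K ^ 10 + 1)) =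
      1 / 2 * K * w₁ * (K * (2 * (K ^ 5)⁻¹) ^ 2 * (3 / 2) ^ 2) +
        1 / 2 * K * w₁ * (S * (2 * (K ^ 5)⁻¹) * (3 / 2)) +
        1 / 2 * K * w₁ * ((2 * (K ^ 5)⁻¹) ^ 2 * β₀) +
        1 / 2 * K * w₁ * ((2 * (K ^ 5)⁻¹) ^ 2 * (3 / 2) * (2 * 10 ^ 5 * K ^ 10 + 1)) := by ring
  rw [hsplit]
  have : (30 + 9 : ℕ) = 39 := by norm_num
  rw [this] at hfin
  nlinarith


/-! ### Sizes of the secondary contributions -/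

/-- The secondary coarse modes carry little energy: `½(b₋₁² + c₋₁²) ≤ K⁻⁴⁰` on `[0, t₂]`
((6.172), (6.169): "`Ẽ₋₁ = ½(a₋₁² + d₋₁²) + O(ε²)`"). [cite: Tao2016AveragedNS, §6.7 proof of Prop. 6.17] -/
theorem Setting.coarse_secondary_sq_le (hs : Setting ε₀ K ε C₁ C₂ C₃ C₄ C₅ n₀ N τ Y F T) (hN : n₀ < N)
    {t₂ : ℝ} (ht₂ : t₂ ≤ T) (ht₂3 : t₂ ≤ 3) {t : ℝ} (ht : t ∈ Icc 0 t₂) :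
    1 / 2 * (Y 1 (-1) t ^ 2 + Y 2 (-1) t ^ 2) ≤ (K ^ 40)⁻¹ := by
  have hε := hs.ε_pos
  have hK := hs.K_pos
  have hb := hs.coarse_b_abs_le hN ht₂ ht₂3 ht
  have hc := hs.coarse_c_abs_le_regime hN ht₂ ht₂3 ht
  have hb2 : Y 1 (-1) t ^ 2 ≤ (2 * 10 ^ 5 * ε) ^ 2 := by
    rw [← sq_abs]; exact pow_le_pow_left₀ (abs_nonneg _) hb 2
  have hc2 : Y 2 (-1) t ^ 2 ≤ (Real.exp (7 * 10 ^ 5 * K ^ 10) * ε ^ 2) ^ 2 := by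
    rw [← sq_abs]; exact pow_le_pow_left₀ (abs_nonneg _) hc 2
  have hc3 : (Real.exp (7 * 10 ^ 5 * K ^ 10) * ε ^ 2) ^ 2 ≤ ε ^ 2 := by
    have e1 : (Real.exp (7 * 10 ^ 5 * K ^ 10) * ε ^ 2) ^ 2 =
        ε ^ 2 * (ε ^ 2 * Real.exp (14 * 10 ^ 5 * K ^ 10)) := by
      have : (Real.exp (7 * 10 ^ 5 * K ^ 10)) ^ 2 = Real.exp (14 * 10 ^ 5 * K ^ 10) := by
        rw [← Real.exp_nat_mul]; congr 1; push_cast; ring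
      rw [mul_pow, this]; ring
    rw [e1]
    have h2 := hs.ε_sq_mul_exp_le hε (14 * 10 ^ 5)
    have h3 : Real.exp (-(2 * 10 ^ 6 - 14 * 10 ^ 5) * K ^ 10) ≤ 1 := by
      rw [Real.exp_le_one_iff]; have := pow_nonneg hK.le 10; nlinarith
    calc ε ^ 2 * (ε ^ 2 * Real.exp (14 * 10 ^ 5 * K ^ 10)) ≤ ε ^ 2 * 1 := by
          gcongr; exact h2.trans h3
      _ = ε ^ 2 := mul_one _
  have hεK : ε ≤ (K ^ 100)⁻¹ := hs.ε_le_K100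
  have hε1 := hs.ε_le_one hε
  have hε2 : ε ^ 2 ≤ (K ^ 100)⁻¹ := by nlinarith
  -- `3·10¹⁰ K⁻¹⁰⁰ ≤ K⁻⁴⁰`
  have h9 : (3 : ℝ) * 10 ^ 10 ≤ K ^ 9 := by
    calc (3 : ℝ) * 10 ^ 10 ≤ (10 ^ 6) ^ 9 := by norm_num
      _ ≤ K ^ 9 := pow_le_pow_left₀ (by norm_num) hs.K_large 9
  have hfin : 3 * 10 ^ 10 * (K ^ (91 + 9))⁻¹ ≤ (K ^ 91)⁻¹ := hs.const_mul_inv_pow_le h9 91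
  have h91 : (K ^ 91)⁻¹ ≤ (K ^ 40)⁻¹ := hs.inv_pow_anti (by norm_num)
  have : (91 + 9 : ℕ) = 100 := by norm_num
  rw [this] at hfin
  nlinarith

/-- The correction is tiny: `|½K · coarseCorr| ≤ K⁻⁴⁰` whenever `1/(ρc₋₁) ≤ w₁ ≤ 16K⁻⁴⁰` ((6.178):
"`E* = Ẽ₋₁ + O(K⁻¹⁰⁰)`"). [cite: Tao2016AveragedNS, §6.7 (6.178)] -/
theorem Setting.half_K_coarseCorr_abs_le (hs : Setting ε₀ K ε C₁ C₂ C₃ C₄ C₅ n₀ N τ Y F T)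
    (hN : n₀ < N) {t₂ : ℝ} (ht₂ : t₂ ≤ T) (ht₂3 : t₂ ≤ 3) {t : ℝ} (ht : t ∈ Icc 0 t₂) {w₁ : ℝ}
    (hw : 1 / (coarseRho ε₀ ε * Y 2 (-1) t) ≤ w₁) (hw1 : w₁ ≤ 16 * (K ^ 40)⁻¹) :
    |1 / 2 * K * coarseCorr ε₀ ε Y t| ≤ (K ^ 40)⁻¹ := by
  have hε := hs.ε_pos
  have hK := hs.K_pos
  have htT : t ∈ Icc 0 T := ⟨ht.1, ht.2.trans ht₂⟩
  have hcC : ε ^ 2 ≤ Y 2 (-1) t := hs.coarse_c_ge_sq hN ht₂ ht₂3 ht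
  have hCpos : 0 < Y 2 (-1) t := lt_of_lt_of_le (by positivity) hcC
  have hρC : 0 < coarseRho ε₀ ε * Y 2 (-1) t := mul_pos hs.coarseRho_pos hCpos
  have ha := hs.abs_Y_negOne_le 0 htT
  have hd := hs.abs_Y_negOne_le 3 htT
  have hb := hs.abs_Y_zero_le 0 htT
  have hw0 : 0 ≤ w₁ := le_trans (by positivity) hw
  have hhalf : (0 : ℝ) < 1 / 2 * K := by positivity
  unfold coarseCorr
  rw [abs_mul, abs_div, abs_of_pos hρC, abs_of_pos hhalf, abs_mul, abs_mul]
  have h1 : |Y 0 (-1) t| * |Y 3 (-1) t| * |Y 0 0 t| / (coarseRho ε₀ ε * Y 2 (-1) t) ≤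
      2 * (K ^ 5)⁻¹ * (2 * (K ^ 5)⁻¹) * (3 / 2) * w₁ := by
    rw [div_eq_mul_one_div]
    gcongr
  calc 1 / 2 * K * (|Y 0 (-1) t| * |Y 3 (-1) t| * |Y 0 0 t| / (coarseRho ε₀ ε * Y 2 (-1) t))
      ≤ 1 / 2 * K * (2 * (K ^ 5)⁻¹ * (2 * (K ^ 5)⁻¹) * (3 / 2) * (16 * (K ^ 40)⁻¹)) := by
        gcongr
        exact h1.trans (by gcongr)
    _ = 48 * (K ^ (40 + 9))⁻¹ := by field_simp; ring
    _ ≤ (K ^ 40)⁻¹ := hs.const_mul_inv_pow_le (le_trans (by norm_num) hs.ten8_le_K9) 40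

/-- Lemma 6.9's constant at scale `-1` is tiny: `C₅ (1+ε₀)^{-n₀/2} ≤ K⁻⁴⁰`. [cite: Tao2016AveragedNS, §6.5 Lemma 6.9] -/
theorem Setting.eta_nine_le (hs : Setting ε₀ K ε C₁ C₂ C₃ C₄ C₅ n₀ N τ Y F T) :
    C₅ * (1 + ε₀) ^ (-(n₀ : ℝ) / 2) ≤ (K ^ 40)⁻¹ := by
  have hε := hs.ε_pos
  have h := hs.C_late hs.ε₀_pos hε hs.C₁_nn hs.C₂_nn hs.C₅_nn hs.C₅_nn
    (by linarith [hs.C₁_nn, hs.C₂_nn])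
  refine h.trans ?_
  have hε1 := hs.ε_le_one hε
  have h1 : ε ^ 4 ≤ 1 := pow_le_one₀ hε.le hε1
  have h2 : Real.exp (-10 * K ^ 10) ≤ (K ^ 40)⁻¹ := by
    rw [neg_mul]; exact hs.exp_neg_mul_K10_le (by norm_num)
  calc ε ^ 4 * Real.exp (-10 * K ^ 10) ≤ 1 * (K ^ 40)⁻¹ := by gcongr
    _ = _ := one_mul _

/-! ### The differential inequality for `E*` -/

/-- **`∂ₜE* ≤ -K a₀ E* + 10K⁻¹⁴`, pointwise form.** At a time `t ∈ [0, t₂]` (`t₂ ≤ min T 3`, `N > n₀`),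
given a weight bound `1/(ρc₋₁(t)) ≤ w₁` and a bound `|∂ₜa₀(t)| ≤ β₀` with `w₁ ≤ 16K⁻⁴⁰`,
`w₁β₀ ≤ 32K⁻⁴⁰` (the two regimes `t ≤ t_c` / `t ≥ t_c` of the zero scale supply these, see
`coarseEnergyDeriv_le_early/late`): the energy inequality (6.49) at scale `-1` ((6.177)), the
equations (6.134), (6.137), the bounds (6.172)–(6.173) and Lemma 6.9 give
`∂ₜE* ≤ -½K(a₋₁²+d₋₁²)a₀ + O(K⁻¹⁴) ≤ -K a₀ E* + 10K⁻¹⁴`. [cite: Tao2016AveragedNS, §6.7 proof of Prop. 6.17] -/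
theorem Setting.coarseEnergyDeriv_le_of (hs : Setting ε₀ K ε C₁ C₂ C₃ C₄ C₅ n₀ N τ Y F T)
    (hN : n₀ < N) {t₂ : ℝ} (ht₂ : t₂ ≤ T) (ht₂3 : t₂ ≤ 3) {t : ℝ} (ht : t ∈ Icc 0 t₂) {w₁ β₀ : ℝ}
    (hw : 1 / (coarseRho ε₀ ε * Y 2 (-1) t) ≤ w₁) (hB' : |dY (τ (n₀ - N)) Y 0 0 t| ≤ β₀)
    (hw1 : w₁ ≤ 16 * (K ^ 40)⁻¹) (hw2 : w₁ * β₀ ≤ 32 * (K ^ 40)⁻¹) :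
    coarseEnergyDeriv ε₀ K ε (τ (n₀ - N)) Y F t ≤
      -K * Y 0 0 t * coarseEnergy ε₀ K ε Y F t + 10 * (K ^ 14)⁻¹ := by
  have hε := hs.ε_pos
  have hK := hs.K_pos
  have htT : t ∈ Icc 0 T := ⟨ht.1, ht.2.trans ht₂⟩
  have ht0 : τ (n₀ - N) ≤ t := hs.τ₀_le.trans ht.1
  have hε₀' : -1 < ε₀ := by linarith [hs.ε₀_pos]
  have hF1 : F (-1) t ≤ 2 * (K ^ 10)⁻¹ := hs.F_negOne_le htT
  have hF2 : F (-2) t ≤ 2 * (K ^ 10)⁻¹ := hs.F_negTwo_le htT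
  have hcC : ε ^ 2 ≤ Y 2 (-1) t := hs.coarse_c_ge_sq hN ht₂ ht₂3 ht
  have hCpos : 0 < Y 2 (-1) t := lt_of_lt_of_le (by positivity) hcC
  have hρ : 0 < coarseRho ε₀ ε := hs.coarseRho_pos
  -- inputs of the pointwise algebra
  have hcL : |dY (τ (n₀ - N)) Y 2 (-1) t| ≤ (2 * 10 ^ 5 * K ^ 10 + 1) * Y 2 (-1) t :=
    hs.coarse_dc_le hN ht₂ ht₂3 ht
  have ha : |Y 0 (-1) t| ≤ 2 * (K ^ 5)⁻¹ := hs.abs_Y_negOne_le 0 htT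
  have hd : |Y 3 (-1) t| ≤ 2 * (K ^ 5)⁻¹ := hs.abs_Y_negOne_le 3 htT
  have hb : |Y 0 0 t| ≤ 3 / 2 := hs.abs_Y_zero_le 0 htT
  have he₁ : |dY (τ (n₀ - N)) Y 0 (-1) t + coarseRho ε₀ ε * Y 2 (-1) t * Y 3 (-1) t| ≤
      (1 + ε₀) ^ (-((5 : ℝ) / 2)) * (2 * ε * (2 * (K ^ 10)⁻¹) +
        2 * ε ^ 2 * Real.exp (-K ^ 10) * (2 * (K ^ 10)⁻¹) + 2 * K * (2 * (K ^ 10)⁻¹)) +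
      C₁ * (1 + ε₀) ^ (-2 - (n₀ : ℝ) / 2) * Real.sqrt (2 * (K ^ 10)⁻¹) := by
    have := hs.hyp.eq_a_neg_one hε.le hK.le hs.C₁_nn hε₀' ht0 hF1 hF2
    unfold dY coarseRho
    exact this
  have he₄ : |dY (τ (n₀ - N)) Y 3 (-1) t -
      (coarseRho ε₀ ε * Y 2 (-1) t * Y 0 (-1) t - K * Y 3 (-1) t * Y 0 0 t)| ≤
      C₁ * (1 + ε₀) ^ (-2 - (n₀ : ℝ) / 2) * Real.sqrt (2 * (K ^ 10)⁻¹) := by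
    have := hs.hyp.eq_d_neg_one hs.C₁_nn hε₀' ht0 hF1
    unfold dY coarseRho
    exact this
  have hE : dF (τ (n₀ - N)) F (-1) t ≤ -K * Y 3 (-1) t ^ 2 * Y 0 0 t +
      2 * K * (1 + ε₀) ^ (-((5 : ℝ) / 2)) * (2 * (K ^ 10)⁻¹) * Real.sqrt (2 * (2 * (K ^ 10)⁻¹)) := by
    have := hs.hyp.energy_neg_one_deriv_le hK.le hε₀' ht0 hF1 hF2
    show derivWithin (F (-1)) (Ici (τ (n₀ - N))) t ≤ _
    linarith
  have alg := coarseModifiedEnergy_algebra hρ hK.le hCpos hw hcL ha hd hb hB' he₁ he₄ hE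
  -- the signed rate via the energy defect (Lemma 6.9 at scale `-1`)
  have hcorr := hs.half_K_coarseCorr_abs_le hN ht₂ ht₂3 ht hw hw1
  have hs0 : 0 ≤ 1 / 2 * (Y 1 (-1) t ^ 2 + Y 2 (-1) t ^ 2) := by positivity
  have hη₉ : 0 ≤ C₅ * (1 + ε₀) ^ (-(n₀ : ℝ) / 2) := mul_nonneg hs.C₅_nn (Real.rpow_nonneg hs.q_pos.le _)
  have hElo : 1 / 2 * (Y 0 (-1) t ^ 2 + Y 3 (-1) t ^ 2) + 1 / 2 * (Y 1 (-1) t ^ 2 + Y 2 (-1) t ^ 2) ≤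
      F (-1) t := by
    have := hs.hyp.defect_lower (-1) t ht0
    simp only [Fin.sum_univ_four] at this
    linarith
  have hEhi : F (-1) t ≤ 1 / 2 * (Y 0 (-1) t ^ 2 + Y 3 (-1) t ^ 2) +
      1 / 2 * (Y 1 (-1) t ^ 2 + Y 2 (-1) t ^ 2) + C₅ * (1 + ε₀) ^ (-(n₀ : ℝ) / 2) := by
    have := hs.prim.negOne t htT
    simp only [Fin.sum_univ_four] at this
    linarith
  have rate := coarse_rate_algebra (A := Y 0 (-1) t) (D := Y 3 (-1) t) hK.le hb hcorr hs0 hη₉ hElo hEhi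
  -- sizes
  have hθ := hs.theta_le
  have hη₁ := hs.eta_one_le
  have hη : C₁ * (1 + ε₀) ^ (-2 - (n₀ : ℝ) / 2) * Real.sqrt (2 * (K ^ 10)⁻¹) ≤ (K ^ 9)⁻¹ := by
    have h1 : C₁ * (1 + ε₀) ^ (-2 - (n₀ : ℝ) / 2) * Real.sqrt (2 * (K ^ 10)⁻¹) ≤ ε ^ 2 * (K ^ 100)⁻¹ :=
      hs.eta_le.trans hs.late_le_ε_sq
    have h2 : (K ^ 100)⁻¹ ≤ (K ^ 9)⁻¹ := hs.inv_pow_anti (by norm_num)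
    have hε1 := hs.ε_le_one hε
    calc _ ≤ ε ^ 2 * (K ^ 100)⁻¹ := h1
      _ ≤ 1 * (K ^ 9)⁻¹ := by gcongr; nlinarith
      _ = _ := one_mul _
  have hS0 : 0 ≤ (1 + ε₀) ^ (-((5 : ℝ) / 2)) * (2 * ε * (2 * (K ^ 10)⁻¹) +
        2 * ε ^ 2 * Real.exp (-K ^ 10) * (2 * (K ^ 10)⁻¹) + 2 * K * (2 * (K ^ 10)⁻¹)) +
      C₁ * (1 + ε₀) ^ (-2 - (n₀ : ℝ) / 2) * Real.sqrt (2 * (K ^ 10)⁻¹) +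
      C₁ * (1 + ε₀) ^ (-2 - (n₀ : ℝ) / 2) * Real.sqrt (2 * (K ^ 10)⁻¹) := by
    have := hs.eta_nonneg
    have hQ0 := hs.Q_pos
    positivity
  have hjunk := hs.junk_le hw1 hw2 hS0 (by linarith)
  have hsec := hs.coarse_secondary_sq_le hN ht₂ ht₂3 ht
  have hη₉' := hs.eta_nine_le
  -- `K · (3/2) · 3K⁻⁴⁰ ≤ K⁻³⁰` and `K⁻³⁰ ≤ K⁻¹⁴`
  have hK40 : K * (3 / 2) * ((K ^ 40)⁻¹ + (K ^ 40)⁻¹ + (K ^ 40)⁻¹) ≤ (K ^ 30)⁻¹ := by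
    have : K * (3 / 2) * ((K ^ 40)⁻¹ + (K ^ 40)⁻¹ + (K ^ 40)⁻¹) = 9 / 2 * (K ^ (30 + 9))⁻¹ := by
      field_simp; ring
    rw [this]
    exact hs.const_mul_inv_pow_le (le_trans (by norm_num) hs.ten8_le_K9) 30
  have hK30 : (K ^ 30)⁻¹ ≤ (K ^ 14)⁻¹ := hs.inv_pow_anti (by norm_num)
  have hK14 : 0 < (K ^ 14)⁻¹ := by positivity
  have hmono : K * (3 / 2) * ((K ^ 40)⁻¹ + 1 / 2 * (Y 1 (-1) t ^ 2 + Y 2 (-1) t ^ 2) +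
      C₅ * (1 + ε₀) ^ (-(n₀ : ℝ) / 2)) ≤ K * (3 / 2) * ((K ^ 40)⁻¹ + (K ^ 40)⁻¹ + (K ^ 40)⁻¹) :=
    mul_le_mul_of_nonneg_left (add_le_add (add_le_add le_rfl hsec) hη₉') (by positivity)
  change coarseEnergyDeriv ε₀ K ε (τ (n₀ - N)) Y F t ≤ _ at alg
  change _ ≤ -K * Y 0 0 t * coarseEnergy ε₀ K ε Y F t + _ at rate
  linarith [alg, rate, hθ, hjunk, hK40, hK30, hmono]


/-! ### The two regimes of the zero scale: the weight `1/(ρc₋₁)` against `|∂ₜa₀|` -/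

/-- `|∂ₜa₀| ≤ (3/2)ε⁻²|c₀| + 1` on `[0, T]` (from (6.129)). [cite: Tao2016AveragedNS, §6.6 (6.129)] -/
theorem Setting.abs_da_zero_le (hs : Setting ε₀ K ε C₁ C₂ C₃ C₄ C₅ n₀ N τ Y F T) {t : ℝ}
    (ht : t ∈ Icc 0 T) : |dY (τ (n₀ - N)) Y 0 0 t| ≤ 3 / 2 * (ε ^ 2)⁻¹ * |Y 2 0 t| + 1 := by
  have hε := hs.ε_pos
  have hK := hs.K_pos
  have h := hs.da_zero ht
  have hF1 : F (-1) t ≤ 2 * (K ^ 10)⁻¹ := hs.F_negOne_le ht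
  have hρε := hs.ρ_le_ε
  have hεK := hs.ε_le_K100
  have hd := hs.abs_Y_zero_le 3 ht
  have hK9 : 2 * K * (2 * (K ^ 10)⁻¹) = 4 * (K ^ 9)⁻¹ := by field_simp; ring
  have hK9' : (K ^ 9)⁻¹ ≤ 1 / 10 ^ 6 := hs.inv_K_pow_le_inv_ten6 (by norm_num)
  have hK100 : (K ^ 100)⁻¹ ≤ 1 / 10 ^ 6 := hs.inv_K_pow_le_inv_ten6 (by norm_num)
  have hprod : |(ε ^ 2)⁻¹ * Y 2 0 t * Y 3 0 t| ≤ 3 / 2 * (ε ^ 2)⁻¹ * |Y 2 0 t| := by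
    rw [abs_mul, abs_mul, abs_of_pos (by positivity : (0:ℝ) < (ε ^ 2)⁻¹)]
    have h0 : 0 ≤ (ε ^ 2)⁻¹ * |Y 2 0 t| := by positivity
    nlinarith
  have htri := abs_sub_abs_le_abs_sub (dY (τ (n₀ - N)) Y 0 0 t) (-((ε ^ 2)⁻¹ * Y 2 0 t * Y 3 0 t))
  rw [sub_neg_eq_add, abs_neg] at htri
  have hKF : 2 * K * F (-1) t ≤ 4 * (K ^ 9)⁻¹ := by
    calc 2 * K * F (-1) t ≤ 2 * K * (2 * (K ^ 10)⁻¹) := by gcongr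
      _ = _ := hK9
  linarith

/-- **Early regime** (`t ≤ t_c`: `|c₀| ≤ K⁻¹⁰ε²`): the weight `w₁ = 1/(ρc₋₁) ≤ 16e^{-K⁹} ≤ 16K⁻⁴⁰` and
`w₁ |∂ₜa₀| ≤ 32K⁻⁴⁰`. [cite: Tao2016AveragedNS, §6.7 proof of Prop. 6.17] -/
theorem Setting.coarse_weights_early (hs : Setting ε₀ K ε C₁ C₂ C₃ C₄ C₅ n₀ N τ Y F T) (hN : n₀ < N)
    {t₂ : ℝ} (ht₂ : t₂ ≤ T) (ht₂3 : t₂ ≤ 3) {t : ℝ} (ht : t ∈ Icc 0 t₂)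
    (hc : |Y 2 0 t| ≤ (K ^ 10)⁻¹ * ε ^ 2) :
    1 / (coarseRho ε₀ ε * Y 2 (-1) t) ≤ 16 * (K ^ 40)⁻¹ ∧
      1 / (coarseRho ε₀ ε * Y 2 (-1) t) * (3 / 2 * (ε ^ 2)⁻¹ * |Y 2 0 t| + 1) ≤ 32 * (K ^ 40)⁻¹ := by
  have hε := hs.ε_pos
  have hK := hs.K_pos
  have htT : t ∈ Icc 0 T := ⟨ht.1, ht.2.trans ht₂⟩
  have hm : 0 < Real.exp (K ^ 9) / 2 * ε ^ 2 := by positivity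
  have hw := hs.inv_rho_mul_le hm (hs.coarse_c_ge_expK9 hN ht₂ ht₂3 ht)
  have hw' : 8 * ε ^ 2 / (Real.exp (K ^ 9) / 2 * ε ^ 2) = 16 * Real.exp (-K ^ 9) := by
    rw [Real.exp_neg]; field_simp; ring
  rw [hw'] at hw
  have he := hs.exp_neg_K9_le
  have hw1 : 1 / (coarseRho ε₀ ε * Y 2 (-1) t) ≤ 16 * (K ^ 40)⁻¹ := hw.trans (by gcongr)
  have hβ : 3 / 2 * (ε ^ 2)⁻¹ * |Y 2 0 t| + 1 ≤ 2 := by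
    have h1 : 3 / 2 * (ε ^ 2)⁻¹ * |Y 2 0 t| ≤ 3 / 2 * (ε ^ 2)⁻¹ * ((K ^ 10)⁻¹ * ε ^ 2) := by gcongr
    have h2 : 3 / 2 * (ε ^ 2)⁻¹ * ((K ^ 10)⁻¹ * ε ^ 2) = 3 / 2 * (K ^ 10)⁻¹ := by field_simp
    have h3 : (K ^ 10)⁻¹ ≤ 1 / 2 := hs.inv_K_pow_le_half (by norm_num)
    linarith
  have hw0 : 0 ≤ 1 / (coarseRho ε₀ ε * Y 2 (-1) t) := by
    have hc' := hs.coarse_c_ge_sq hN ht₂ ht₂3 ht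
    have : 0 < Y 2 (-1) t := lt_of_lt_of_le (by positivity) hc'
    have := hs.coarseRho_pos
    positivity
  refine ⟨hw1, ?_⟩
  calc 1 / (coarseRho ε₀ ε * Y 2 (-1) t) * (3 / 2 * (ε ^ 2)⁻¹ * |Y 2 0 t| + 1)
      ≤ 16 * (K ^ 40)⁻¹ * 2 := mul_le_mul hw1 hβ (by positivity) (by positivity)
    _ = 32 * (K ^ 40)⁻¹ := by ring

/-- **Late regime** (`t ≥ t_c ≥ 1/2`: `|c₀| ≤ ε² exp(10⁻⁸K¹⁰)`, (6.167) for `K` large): the weight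
`w₁ = 1/(ρc₋₁) ≤ 8 exp(-6·10⁻⁸K¹⁰) ≤ 16K⁻⁴⁰` and `w₁|∂ₜa₀| ≤ 20 exp(-5·10⁻⁸K¹⁰) ≤ 32K⁻⁴⁰` — the
"mismatch in speeds between the `0`-scale and `-1`-scale dynamics". [cite: Tao2016AveragedNS, §6.7 proof of Prop. 6.17] -/
theorem Setting.coarse_weights_late (hs : Setting ε₀ K ε C₁ C₂ C₃ C₄ C₅ n₀ N τ Y F T) (hN : n₀ < N)
    {t₂ : ℝ} (ht₂ : t₂ ≤ T) (ht₂3 : t₂ ≤ 3) {t : ℝ} (ht : t ∈ Icc 0 t₂) (ht2 : 1 / 2 ≤ t)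
    (hc : |Y 2 0 t| ≤ ε ^ 2 * Real.exp (1 / 10 ^ 8 * K ^ 10)) :
    1 / (coarseRho ε₀ ε * Y 2 (-1) t) ≤ 16 * (K ^ 40)⁻¹ ∧
      1 / (coarseRho ε₀ ε * Y 2 (-1) t) * (3 / 2 * (ε ^ 2)⁻¹ * |Y 2 0 t| + 1) ≤ 32 * (K ^ 40)⁻¹ := by
  have hε := hs.ε_pos
  have hK := hs.K_pos
  have hm : 0 < Real.exp (6 / 10 ^ 8 * K ^ 10) * ε ^ 2 := by positivity
  have hw := hs.inv_rho_mul_le hm (hs.coarse_c_ge_late hN ht₂ ht₂3 ht ht2)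
  have hw' : 8 * ε ^ 2 / (Real.exp (6 / 10 ^ 8 * K ^ 10) * ε ^ 2) = 8 * Real.exp (-(6 / 10 ^ 8 * K ^ 10)) := by
    rw [Real.exp_neg]; field_simp
  rw [hw'] at hw
  have he5 := hs.exp_neg_small_K10_le
  have he6 : Real.exp (-(6 / 10 ^ 8 * K ^ 10)) ≤ (K ^ 40)⁻¹ := by
    refine le_trans (Real.exp_le_exp.2 ?_) he5
    have := pow_nonneg hK.le 10
    nlinarith
  have hw1 : 1 / (coarseRho ε₀ ε * Y 2 (-1) t) ≤ 16 * (K ^ 40)⁻¹ := by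
    calc _ ≤ 8 * Real.exp (-(6 / 10 ^ 8 * K ^ 10)) := hw
      _ ≤ 16 * (K ^ 40)⁻¹ := by nlinarith [Real.exp_pos (-(6 / 10 ^ 8 * K ^ 10))]
  have hβ : 3 / 2 * (ε ^ 2)⁻¹ * |Y 2 0 t| + 1 ≤ 5 / 2 * Real.exp (1 / 10 ^ 8 * K ^ 10) := by
    have h1 : 3 / 2 * (ε ^ 2)⁻¹ * |Y 2 0 t| ≤ 3 / 2 * (ε ^ 2)⁻¹ * (ε ^ 2 * Real.exp (1 / 10 ^ 8 * K ^ 10)) := by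
      gcongr
    have h2 : 3 / 2 * (ε ^ 2)⁻¹ * (ε ^ 2 * Real.exp (1 / 10 ^ 8 * K ^ 10)) =
        3 / 2 * Real.exp (1 / 10 ^ 8 * K ^ 10) := by field_simp
    have h3 : 1 ≤ Real.exp (1 / 10 ^ 8 * K ^ 10) := Real.one_le_exp (by positivity)
    linarith
  have hw0 : 0 ≤ 1 / (coarseRho ε₀ ε * Y 2 (-1) t) := by
    have hc' := hs.coarse_c_ge_sq hN ht₂ ht₂3 ht
    have : 0 < Y 2 (-1) t := lt_of_lt_of_le (by positivity) hc'
    have := hs.coarseRho_pos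
    positivity
  refine ⟨hw1, ?_⟩
  have hprod : 8 * Real.exp (-(6 / 10 ^ 8 * K ^ 10)) * (5 / 2 * Real.exp (1 / 10 ^ 8 * K ^ 10)) =
      20 * Real.exp (-(5 / 10 ^ 8 * K ^ 10)) := by
    have : -(6 / 10 ^ 8 * K ^ 10) + 1 / 10 ^ 8 * K ^ 10 = -(5 / 10 ^ 8 * K ^ 10) := by ring
    rw [mul_mul_mul_comm, ← Real.exp_add, this]
    norm_num
  calc 1 / (coarseRho ε₀ ε * Y 2 (-1) t) * (3 / 2 * (ε ^ 2)⁻¹ * |Y 2 0 t| + 1)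
      ≤ 8 * Real.exp (-(6 / 10 ^ 8 * K ^ 10)) * (5 / 2 * Real.exp (1 / 10 ^ 8 * K ^ 10)) :=
        mul_le_mul hw hβ (by positivity) (by positivity)
    _ = 20 * Real.exp (-(5 / 10 ^ 8 * K ^ 10)) := hprod
    _ ≤ 20 * (K ^ 40)⁻¹ := by gcongr
    _ ≤ 32 * (K ^ 40)⁻¹ := by gcongr; norm_num

/-- **`∂ₜE* ≤ -K a₀ E* + 10K⁻¹⁴` on `[0, t₂)`**, given the zero-scale inputs: `|c₀| ≤ K⁻¹⁰ε²` on
`[0, t⋆]` and `|c₀| ≤ ε² exp(10⁻⁸K¹⁰)` on `[t⋆, t₂]`, `t⋆ ≥ 1/2`. [cite: Tao2016AveragedNS, §6.7 proof of Prop. 6.17] -/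
theorem Setting.coarseEnergyDeriv_le (hs : Setting ε₀ K ε C₁ C₂ C₃ C₄ C₅ n₀ N τ Y F T) (hN : n₀ < N)
    {tstar t₂ : ℝ} (hstar : 1 / 2 ≤ tstar) (ht₂ : t₂ ≤ T) (ht₂3 : t₂ ≤ 3)
    (hcA : ∀ t ∈ Icc 0 tstar, |Y 2 0 t| ≤ (K ^ 10)⁻¹ * ε ^ 2)
    (hcB : ∀ t ∈ Icc tstar t₂, |Y 2 0 t| ≤ ε ^ 2 * Real.exp (1 / 10 ^ 8 * K ^ 10))
    {t : ℝ} (ht : t ∈ Icc 0 t₂) :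
    coarseEnergyDeriv ε₀ K ε (τ (n₀ - N)) Y F t ≤
      -K * Y 0 0 t * coarseEnergy ε₀ K ε Y F t + 10 * (K ^ 14)⁻¹ := by
  have htT : t ∈ Icc 0 T := ⟨ht.1, ht.2.trans ht₂⟩
  have hB' := hs.abs_da_zero_le htT
  rcases le_total t tstar with h1 | h1
  · obtain ⟨hw1, hw2⟩ := hs.coarse_weights_early hN ht₂ ht₂3 ht (hcA t ⟨ht.1, h1⟩)
    exact hs.coarseEnergyDeriv_le_of hN ht₂ ht₂3 ht le_rfl hB' hw1 hw2
  · obtain ⟨hw1, hw2⟩ := hs.coarse_weights_late hN ht₂ ht₂3 ht (hstar.trans h1) (hcB t ⟨h1, ht.2⟩)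
    exact hs.coarseEnergyDeriv_le_of hN ht₂ ht₂3 ht le_rfl hB' hw1 hw2

/-! ## Prop. 6.17 -/

/-- **Prop. 6.17 (No exit to coarse scales), in the regime.** Let the hypotheses of §6.7 hold in the
parameter regime (`Setting`, time horizon `T`), and let `1/2 ≤ t⋆`, `t₂ ≤ min T 3` be such that
`|c₀| ≤ K⁻¹⁰ε²` and `a₀ ≥ 0` on `[0, t⋆]` (the time `t⋆ = t_c`: (6.153), (6.156), (6.151)),
`|c₀| ≤ ε² exp(10⁻⁸K¹⁰)` on `[t⋆, t₂]` ((6.167), for `K` large), and `∫ₛᵗ a₀ ≥ -λ` with `Kλ ≤ 1`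
whenever `t⋆ ≤ s ≤ t ≤ t₂` (rotor averaging on `I`, (6.165)/(6.181)). Then `Ẽ₋₁(t) ≤ 100 K⁻¹⁴`
for all `t ∈ [t⋆, t₂]`. [cite: Tao2016AveragedNS, §6.7 Prop. 6.17] -/
theorem Setting.F_negOne_le_of_osc (hs : Setting ε₀ K ε C₁ C₂ C₃ C₄ C₅ n₀ N τ Y F T)
    {tstar t₂ : ℝ} (hstar : 1 / 2 ≤ tstar) (ht₂ : t₂ ≤ T) (ht₂3 : t₂ ≤ 3)
    (hcA : ∀ t ∈ Icc 0 tstar, |Y 2 0 t| ≤ (K ^ 10)⁻¹ * ε ^ 2)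
    (hcB : ∀ t ∈ Icc tstar t₂, |Y 2 0 t| ≤ ε ^ 2 * Real.exp (1 / 10 ^ 8 * K ^ 10))
    (ha₀ : ∀ t ∈ Icc 0 tstar, 0 ≤ Y 0 0 t) {lam : ℝ} (hlam : K * lam ≤ 1)
    (hosc : ∀ s t, tstar ≤ s → s ≤ t → t ≤ t₂ → -lam ≤ ∫ u in s..t, Y 0 0 u)
    {t : ℝ} (ht : t ∈ Icc tstar t₂) : F (-1) t ≤ 100 * (K ^ 14)⁻¹ := by
  have hε := hs.ε_pos
  have hK := hs.K_pos
  have hK14 : 0 < (K ^ 14)⁻¹ := by positivity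
  have ht0 : 0 ≤ t := by linarith [ht.1]
  have ht' : t ∈ Icc 0 t₂ := ⟨ht0, ht.2⟩
  rcases eq_or_lt_of_le hs.le_N with hNeq | hN
  · -- `N = n₀`: no very low frequencies, `Ẽ₋₁ ≡ 0`
    have h0 := hs.hyp.noLow_F (-1) t (by omega) (hs.τ₀_le.trans ht0)
    rw [h0]; positivity
  -- the comparison argument for `E*` on `[0, t₂]`
  have hτ := hs.τ₀_le
  have hEc := hs.continuousOn_coarseEnergy hN ht₂ ht₂3
  have hEd : ∀ u ∈ Ico 0 t₂, HasDerivWithinAt (coarseEnergy ε₀ K ε Y F)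
      (coarseEnergyDeriv ε₀ K ε (τ (n₀ - N)) Y F u) (Ici u) u :=
    fun u hu => hs.hasDerivWithinAt_coarseEnergy hN ht₂ ht₂3 (Ico_subset_Icc_self hu)
  have hac : ContinuousOn (Y 0 0) (Icc 0 t₂) := hs.hyp.continuousOn_X 0 0 hτ
  have hg : (0 : ℝ) ≤ 10 * (K ^ 14)⁻¹ := by positivity
  have hbound : ∀ u ∈ Ico 0 t₂, coarseEnergyDeriv ε₀ K ε (τ (n₀ - N)) Y F u ≤
      -K * Y 0 0 u * coarseEnergy ε₀ K ε Y F u + 10 * (K ^ 14)⁻¹ :=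
    fun u hu => hs.coarseEnergyDeriv_le hN hstar ht₂ ht₂3 hcA hcB (Ico_subset_Icc_self hu)
  -- the kernel bound
  have hint : ∀ {x y : ℝ}, 0 ≤ x → x ≤ y → y ≤ t₂ → IntervalIntegrable (Y 0 0) volume x y :=
    fun hx hxy hy => (hac.mono (Icc_subset_Icc hx hy)).intervalIntegrable_of_Icc hxy
  have hker : ∀ s ∈ Icc 0 t, -lam ≤ ∫ u in s..t, Y 0 0 u := by
    intro s hs'
    rcases le_total tstar s with h1 | h1
    · exact hosc s t h1 hs'.2 ht.2
    · have hsplit : ∫ u in s..t, Y 0 0 u = (∫ u in s..tstar, Y 0 0 u) + ∫ u in tstar..t, Y 0 0 u :=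
        (integral_add_adjacent_intervals (hint hs'.1 h1 (ht.1.trans ht.2))
          (hint (hs'.1.trans h1) ht.1 ht.2)).symm
      have hpos : 0 ≤ ∫ u in s..tstar, Y 0 0 u :=
        intervalIntegral.integral_nonneg h1 fun u hu => ha₀ u ⟨hs'.1.trans hu.1, hu.2⟩
      have h2 := hosc tstar t le_rfl ht.1 ht.2
      rw [hsplit]; linarith
  have hcomp := le_of_oscillating_rate hEc hEd hac hK.le hg hbound ht' hker
  -- sizes at time `0` and at time `t`
  have h0mem : (0 : ℝ) ∈ Icc 0 t₂ := ⟨le_rfl, ht0.trans ht.2⟩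
  obtain ⟨hw0, -⟩ := hs.coarse_weights_early hN ht₂ ht₂3 h0mem (hcA 0 ⟨le_rfl, by linarith⟩)
  have hcorr0 := hs.half_K_coarseCorr_abs_le hN ht₂ ht₂3 h0mem le_rfl hw0
  have hcorrt : |1 / 2 * K * coarseCorr ε₀ ε Y t| ≤ (K ^ 40)⁻¹ := by
    rcases le_total t tstar with h1 | h1
    · obtain ⟨hw1, -⟩ := hs.coarse_weights_early hN ht₂ ht₂3 ht' (hcA t ⟨ht0, h1⟩)
      exact hs.half_K_coarseCorr_abs_le hN ht₂ ht₂3 ht' le_rfl hw1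
    · obtain ⟨hw1, -⟩ := hs.coarse_weights_late hN ht₂ ht₂3 ht' (hstar.trans h1) (hcB t ⟨h1, ht.2⟩)
      exact hs.half_K_coarseCorr_abs_le hN ht₂ ht₂3 ht' le_rfl hw1
  have hE0 : coarseEnergy ε₀ K ε Y F 0 ≤ (K ^ 20)⁻¹ + (K ^ 40)⁻¹ := by
    have h1 := hs.hyp.energy_prev_le
    unfold coarseEnergy
    linarith [(abs_le.mp hcorr0).1]
  -- the exponential factors
  have hexp1 : Real.exp (K * lam) ≤ 3 := (Real.exp_le_exp.2 hlam).trans exp_one_le_three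
  have hexp2 : Real.exp (-(K * ∫ u in (0:ℝ)..t, Y 0 0 u)) ≤ 3 := by
    refine le_trans (Real.exp_le_exp.2 ?_) hexp1
    have := hker 0 ⟨le_rfl, ht0⟩
    nlinarith
  have hfirst : Real.exp (-(K * ∫ u in (0:ℝ)..t, Y 0 0 u)) * coarseEnergy ε₀ K ε Y F 0 ≤
      3 * ((K ^ 20)⁻¹ + (K ^ 40)⁻¹) := by
    rcases le_or_gt 0 (coarseEnergy ε₀ K ε Y F 0) with h1 | h1
    · exact mul_le_mul hexp2 hE0 h1 (by norm_num)
    · have : Real.exp (-(K * ∫ u in (0:ℝ)..t, Y 0 0 u)) * coarseEnergy ε₀ K ε Y F 0 ≤ 0 :=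
        mul_nonpos_of_nonneg_of_nonpos (Real.exp_pos _).le h1.le
      have h2 : 0 ≤ 3 * ((K ^ 20)⁻¹ + (K ^ 40)⁻¹) := by positivity
      linarith
  have hsecond : 10 * (K ^ 14)⁻¹ * (t - 0) * Real.exp (K * lam) ≤ 10 * (K ^ 14)⁻¹ * 3 * 3 := by
    have ht3 : t - 0 ≤ 3 := by linarith [ht.2.trans ht₂3]
    have : 10 * (K ^ 14)⁻¹ * (t - 0) ≤ 10 * (K ^ 14)⁻¹ * 3 := by gcongr
    exact mul_le_mul this hexp1 (Real.exp_pos _).le (by positivity)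
  have hK20 : (K ^ 20)⁻¹ ≤ (K ^ 14)⁻¹ := hs.inv_pow_anti (by norm_num)
  have hK40 : (K ^ 40)⁻¹ ≤ (K ^ 14)⁻¹ := hs.inv_pow_anti (by norm_num)
  have hEt : F (-1) t = coarseEnergy ε₀ K ε Y F t + 1 / 2 * K * coarseCorr ε₀ ε Y t := by
    unfold coarseEnergy; ring
  rw [hEt]
  linarith [(abs_le.mp hcorrt).2]


/-! ## The oscillation hypothesis from the rotor, and corollaries -/

/-- **Sign control of `∫ₛᵗ a₀` past `t_c`** from the fast rotor: if on `I = [t⋆ + K⁻⁹, t₂]` the rotor is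
strongly activated, `c₀ ≥ K²⁰ε²` ((6.165)), and slowly varying, `|∂ₜc₀| ≤ L₀ c₀` with `L₀ ≤ 10⁵K¹⁰`
((6.181)), then `|∫ₛᵗ a₀| ≤ 3K⁻⁹` for `t⋆ ≤ s ≤ t ≤ t₂` (`t₂ ≤ min T 3`): the part before `t⋆ + K⁻⁹`
is short, the rest is `integral_rotor_le` with the `d₀`-equation (6.132).
[cite: Tao2016AveragedNS, §6.7 (6.165), (6.181), proof of Prop. 6.17] -/
theorem Setting.abs_integral_a_zero_le_of_rotor (hs : Setting ε₀ K ε C₁ C₂ C₃ C₄ C₅ n₀ N τ Y F T)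
    {tstar t₂ L₀ : ℝ} (hstar : 0 ≤ tstar) (ht₂ : t₂ ≤ T) (ht₂3 : t₂ ≤ 3) (hL₀ : L₀ ≤ 10 ^ 5 * K ^ 10)
    (hcI : ∀ u ∈ Icc (tstar + (K ^ 9)⁻¹) t₂, K ^ 20 * ε ^ 2 ≤ Y 2 0 u)
    (hdcI : ∀ u ∈ Icc (tstar + (K ^ 9)⁻¹) t₂, |dY (τ (n₀ - N)) Y 2 0 u| ≤ L₀ * Y 2 0 u)
    {s t : ℝ} (hs1 : tstar ≤ s) (hst : s ≤ t) (ht : t ≤ t₂) :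
    |∫ u in s..t, Y 0 0 u| ≤ 3 * (K ^ 9)⁻¹ := by
  have hε := hs.ε_pos
  have hK := hs.K_pos
  have hτ := hs.τ₀_le
  have hK9 : 0 < (K ^ 9)⁻¹ := by positivity
  set t₁ := tstar + (K ^ 9)⁻¹ with ht₁
  set m := max s (min t t₁) with hm
  have hsm : s ≤ m := le_max_left _ _
  have hmt : m ≤ t := max_le hst (min_le_left _ _)
  have hs0 : 0 ≤ s := hstar.trans hs1
  have hm0 : 0 ≤ m := hs0.trans hsm
  have hac : ContinuousOn (Y 0 0) (Icc 0 t₂) := hs.hyp.continuousOn_X 0 0 hτ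
  have hint : ∀ {x y : ℝ}, 0 ≤ x → x ≤ y → y ≤ t₂ → IntervalIntegrable (Y 0 0) volume x y :=
    fun hx hxy hy => (hac.mono (Icc_subset_Icc hx hy)).intervalIntegrable_of_Icc hxy
  have hsplit : ∫ u in s..t, Y 0 0 u = (∫ u in s..m, Y 0 0 u) + ∫ u in m..t, Y 0 0 u :=
    (integral_add_adjacent_intervals (hint hs0 hsm (hmt.trans ht)) (hint hm0 hmt ht)).symm
  -- the short piece
  have hshort : |∫ u in s..m, Y 0 0 u| ≤ 3 / 2 * (K ^ 9)⁻¹ := by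
    have hlen : m - s ≤ (K ^ 9)⁻¹ := by
      have : m ≤ max s t₁ := max_le_max le_rfl (min_le_right _ _)
      have h2 : max s t₁ ≤ s + (K ^ 9)⁻¹ := max_le (by linarith) (by rw [ht₁]; linarith)
      linarith
    have h := norm_integral_le_of_norm_le_const (a := s) (b := m) (f := Y 0 0) (C := 3 / 2) ?_
    · rw [abs_of_nonneg (sub_nonneg.2 hsm)] at h
      rw [Real.norm_eq_abs] at h
      calc |∫ u in s..m, Y 0 0 u| ≤ 3 / 2 * (m - s) := by simpa using h
        _ ≤ 3 / 2 * (K ^ 9)⁻¹ := by gcongr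
    · intro u hu
      rw [uIoc_of_le hsm] at hu
      rw [Real.norm_eq_abs]
      exact hs.abs_Y_zero_le 0 ⟨hs0.trans hu.1.le, hu.2.trans (hmt.trans (ht.trans ht₂))⟩
  -- the rotor piece
  have hrot : |∫ u in m..t, Y 0 0 u| ≤ 3 / 2 * (K ^ 9)⁻¹ := by
    rcases le_or_gt t t₁ with h1 | h1
    · -- `t ≤ t₁`: `m = t`
      have hm' : m = t := by
        rw [hm, min_eq_left h1, max_eq_right hst]
      rw [hm', intervalIntegral.integral_same, abs_zero]; positivity
    · -- `t > t₁`: `m ≥ t₁` and `[m, t] ⊆ I`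
      have hmin : min t t₁ = t₁ := min_eq_right h1.le
      have hm1 : t₁ ≤ m := by rw [hm, hmin]; exact le_max_right _ _
      have hsub : ∀ u ∈ Icc m t, u ∈ Icc t₁ t₂ := fun u hu => ⟨hm1.trans hu.1, hu.2.trans ht⟩
      have hsubT : ∀ u ∈ Icc m t, u ∈ Icc 0 T := fun u hu =>
        ⟨hm0.trans hu.1, hu.2.trans (ht.trans ht₂)⟩
      have hcmin : (0 : ℝ) < K ^ 20 * ε ^ 2 := by positivity
      have hρ : (0 : ℝ) < (ε ^ 2)⁻¹ := by positivity
      have hr := integral_rotor_le (a₀ := Y 0 0) (d₀ := Y 3 0) (c₀ := Y 2 0) (a₁ := Y 0 1)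
        (κ := (1 + ε₀) ^ ((5 : ℝ) / 2) * K) (η := C₁ * (1 + ε₀) ^ (-(n₀ : ℝ) / 2)) (L := L₀)
        (M := 3 / 2) (hs.hyp.contDiffOn_Y 3 0) (hs.hyp.contDiffOn_Y 2 0)
        (hac.mono (Icc_subset_Icc hm0 ht)) (hτ.trans hm0) hmt hρ hcmin
        (fun u hu => hcI u (hsub u hu)) (fun u hu => hdcI u (hsub u hu))
        (fun u hu => hs.abs_Y_zero_le 3 (hsubT u hu)) (fun u hu => hs.abs_Y_one_le 0 (hsubT u hu))
        (fun u hu => hs.dd_zero (hsubT u hu))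
      refine hr.trans ?_
      -- numerics: `ρ c_min = K²⁰`, numerator `≤ 3/2 · 10⁶ K¹⁰`... `≤ 3/2 K⁻⁹`
      have hρc : (ε ^ 2)⁻¹ * (K ^ 20 * ε ^ 2) = K ^ 20 := by field_simp
      rw [hρc]
      have hq : (1 + ε₀) ^ ((5 : ℝ) / 2) ≤ 8 := hs.q52_le
      have hq0 : 0 ≤ (1 + ε₀) ^ ((5 : ℝ) / 2) := Real.rpow_nonneg hs.q_pos.le _
      have hκ : |(1 + ε₀) ^ ((5 : ℝ) / 2) * K| ≤ 8 * K := by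
        rw [abs_of_nonneg (by positivity)]; gcongr
      have hη : C₁ * (1 + ε₀) ^ (-(n₀ : ℝ) / 2) ≤ 1 := hs.ρ_le_ε.trans (hs.ε_le_one hε)
      have hη0 : 0 ≤ C₁ * (1 + ε₀) ^ (-(n₀ : ℝ) / 2) := mul_nonneg hs.C₁_nn (Real.rpow_nonneg hs.q_pos.le _)
      have htm : t - m ≤ 3 := by linarith [ht.trans ht₂3]
      have htm0 : 0 ≤ t - m := sub_nonneg.2 hmt
      have hL0 : 0 ≤ L₀ := by
        have h2 := hdcI t ⟨h1.le, ht⟩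
        have hc2 : 0 < Y 2 0 t := hcmin.trans_le (hcI t ⟨h1.le, ht⟩)
        exact nonneg_of_mul_nonneg_left ((abs_nonneg _).trans h2) hc2
      have hnum : 2 * (3 / 2) + (3 / 2 * L₀ + |(1 + ε₀) ^ ((5 : ℝ) / 2) * K| * (3 / 2) ^ 2 +
          C₁ * (1 + ε₀) ^ (-(n₀ : ℝ) / 2)) * (t - m) ≤ 3 / 2 * 10 ^ 6 * K ^ 10 := by
        have h2 : 3 / 2 * L₀ + |(1 + ε₀) ^ ((5 : ℝ) / 2) * K| * (3 / 2) ^ 2 +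
            C₁ * (1 + ε₀) ^ (-(n₀ : ℝ) / 2) ≤ 3 / 2 * (10 ^ 5 * K ^ 10) + 8 * K * (3 / 2) ^ 2 + 1 := by
          gcongr
        have h3 : (3 / 2 * (10 ^ 5 * K ^ 10) + 8 * K * (3 / 2) ^ 2 + 1) * (t - m) ≤
            (3 / 2 * (10 ^ 5 * K ^ 10) + 8 * K * (3 / 2) ^ 2 + 1) * 3 := by
          apply mul_le_mul_of_nonneg_left htm; positivity
        have hK1 := hs.one_le_K
        have hK10 : K ≤ K ^ 10 := by
          calc K = K ^ 1 := (pow_one K).symm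
            _ ≤ K ^ 10 := pow_le_pow_right₀ hK1 (by norm_num)
        nlinarith [mul_le_mul_of_nonneg_right h2 htm0]
      rw [div_le_iff₀ (pow_pos hK 20)]
      refine hnum.trans ?_
      have : 3 / 2 * (K ^ 9)⁻¹ * K ^ 20 = 3 / 2 * K * K ^ 10 := by field_simp
      rw [this]
      have hK6 := hs.K_large
      have := pow_nonneg hK.le 10
      nlinarith
  rw [hsplit]
  calc |(∫ u in s..m, Y 0 0 u) + ∫ u in m..t, Y 0 0 u|
      ≤ |∫ u in s..m, Y 0 0 u| + |∫ u in m..t, Y 0 0 u| := abs_add_le _ _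
    _ ≤ 3 / 2 * (K ^ 9)⁻¹ + 3 / 2 * (K ^ 9)⁻¹ := add_le_add hshort hrot
    _ = 3 * (K ^ 9)⁻¹ := by ring

/-- **Prop. 6.17 with the rotor data as input**: under the hypotheses of `F_negOne_le_of_osc` with the
oscillation hypothesis replaced by `c₀ ≥ K²⁰ε²` and `|∂ₜc₀| ≤ L₀c₀` (`L₀ ≤ 10⁵K¹⁰`) on
`[t⋆ + K⁻⁹, t₂]`, `Ẽ₋₁ ≤ 100K⁻¹⁴` on `[t⋆, t₂]`. [cite: Tao2016AveragedNS, §6.7 Prop. 6.17] -/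
theorem Setting.F_negOne_le_of_rotor (hs : Setting ε₀ K ε C₁ C₂ C₃ C₄ C₅ n₀ N τ Y F T)
    {tstar t₂ L₀ : ℝ} (hstar : 1 / 2 ≤ tstar) (ht₂ : t₂ ≤ T) (ht₂3 : t₂ ≤ 3)
    (hL₀ : L₀ ≤ 10 ^ 5 * K ^ 10)
    (hcA : ∀ t ∈ Icc 0 tstar, |Y 2 0 t| ≤ (K ^ 10)⁻¹ * ε ^ 2)
    (hcB : ∀ t ∈ Icc tstar t₂, |Y 2 0 t| ≤ ε ^ 2 * Real.exp (1 / 10 ^ 8 * K ^ 10))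
    (ha₀ : ∀ t ∈ Icc 0 tstar, 0 ≤ Y 0 0 t)
    (hcI : ∀ u ∈ Icc (tstar + (K ^ 9)⁻¹) t₂, K ^ 20 * ε ^ 2 ≤ Y 2 0 u)
    (hdcI : ∀ u ∈ Icc (tstar + (K ^ 9)⁻¹) t₂, |dY (τ (n₀ - N)) Y 2 0 u| ≤ L₀ * Y 2 0 u)
    {t : ℝ} (ht : t ∈ Icc tstar t₂) : F (-1) t ≤ 100 * (K ^ 14)⁻¹ := by
  have hK := hs.K_pos
  have hlam : K * (3 * (K ^ 9)⁻¹) ≤ 1 := by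
    have : K * (3 * (K ^ 9)⁻¹) = 3 * (K ^ 8)⁻¹ := by field_simp
    rw [this]
    have h8 : (K ^ 8)⁻¹ ≤ 1 / 10 ^ 6 := hs.inv_K_pow_le_inv_ten6 (by norm_num)
    linarith
  refine hs.F_negOne_le_of_osc hstar ht₂ ht₂3 hcA hcB ha₀ hlam ?_ ht
  intro s u hsu hst hut
  have := hs.abs_integral_a_zero_le_of_rotor (by linarith) ht₂ ht₂3 hL₀ hcI hdcI hsu hst hut
  exact (abs_le.mp this).1

/-- **The "backwards flow of energy" exit is excluded past `t_c`**: under the hypotheses of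
`F_negOne_le_of_osc`, `Ẽ₋₁(t) < K⁻¹⁰(1+ε₀)^{2/10}` on `[t⋆, t₂]` (so the first alternative (6.161) of
Prop. 6.16 cannot occur, whence (6.175) `τ₁ = t_c + K^{-1/2}`). [cite: Tao2016AveragedNS, §6.7 Prop. 6.17 (6.175)] -/
theorem Setting.F_negOne_lt_exit_of_osc (hs : Setting ε₀ K ε C₁ C₂ C₃ C₄ C₅ n₀ N τ Y F T)
    {tstar t₂ : ℝ} (hstar : 1 / 2 ≤ tstar) (ht₂ : t₂ ≤ T) (ht₂3 : t₂ ≤ 3)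
    (hcA : ∀ t ∈ Icc 0 tstar, |Y 2 0 t| ≤ (K ^ 10)⁻¹ * ε ^ 2)
    (hcB : ∀ t ∈ Icc tstar t₂, |Y 2 0 t| ≤ ε ^ 2 * Real.exp (1 / 10 ^ 8 * K ^ 10))
    (ha₀ : ∀ t ∈ Icc 0 tstar, 0 ≤ Y 0 0 t) {lam : ℝ} (hlam : K * lam ≤ 1)
    (hosc : ∀ s t, tstar ≤ s → s ≤ t → t ≤ t₂ → -lam ≤ ∫ u in s..t, Y 0 0 u)
    {t : ℝ} (ht : t ∈ Icc tstar t₂) : F (-1) t < (K ^ 10)⁻¹ * (1 + ε₀) ^ ((2 : ℝ) / 10) := by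
  have h := hs.F_negOne_le_of_osc hstar ht₂ ht₂3 hcA hcB ha₀ hlam hosc ht
  have hK := hs.K_pos
  have hq : 1 ≤ (1 + ε₀) ^ ((2 : ℝ) / 10) := hs.one_le_q_rpow (by norm_num)
  have hK10 : 0 < (K ^ 10)⁻¹ := by positivity
  have h14 : 100 * (K ^ 14)⁻¹ < (K ^ 10)⁻¹ := by
    have h1 : 100 * (K ^ 14)⁻¹ = 100 * (K ^ 4)⁻¹ * (K ^ 10)⁻¹ := by field_simp
    rw [h1]
    have h4 : (K ^ 4)⁻¹ ≤ 1 / 10 ^ 6 := hs.inv_K_pow_le_inv_ten6 (by norm_num)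
    have : 100 * (K ^ 4)⁻¹ < 1 := by linarith
    calc 100 * (K ^ 4)⁻¹ * (K ^ 10)⁻¹ < 1 * (K ^ 10)⁻¹ := by gcongr
      _ = _ := one_mul _
  calc F (-1) t ≤ 100 * (K ^ 14)⁻¹ := h
    _ < (K ^ 10)⁻¹ := h14
    _ = (K ^ 10)⁻¹ * 1 := (mul_one _).symm
    _ ≤ (K ^ 10)⁻¹ * (1 + ε₀) ^ ((2 : ℝ) / 10) := by gcongr

end ModifiedEnergy

/-! ## Prop. 6.17 on the rotor phase `[t_c, τ₁]` and (6.175) `τ₁ = t_c + K^{-1/2}` -/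

section RotorPhase

variable {ε₀ K ε C₁ C₂ C₃ C₄ C₅ : ℝ} {n₀ N : ℤ} {τ : ℤ → ℝ} {Y : Fin 4 → ℤ → ℝ → ℝ}
  {F : ℤ → ℝ → ℝ} {T : ℝ}

/-- **(6.167) beats (6.171) for `K ≥ 10¹⁸`**: on `[t_c, τ₁]`, `|c₀| ≤ 2K⁻¹⁰ε² exp(4K¹⁰K^{-1/2}) ≤
ε² exp(10⁻⁸K¹⁰)` (the "mismatch in speeds"; the largeness `√K ≥ 4·10⁸` is where "`K` sufficiently
large" enters Prop. 6.17 beyond the regime `K ≥ 10⁶` of `ZeroScale.Regime`).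
[cite: Tao2016AveragedNS, §6.7 (6.167)] -/
theorem Setting.abs_c_zero_rotor_le (hs : Setting ε₀ K ε C₁ C₂ C₃ C₄ C₅ n₀ N τ Y F T)
    (hex : ExitTrichotomy ε₀ K Y F T) (hK18 : (10 : ℝ) ^ 18 ≤ K) {t : ℝ}
    (ht : t ∈ Icc (tc K ε Y T) (τone K ε Y T)) :
    |Y 2 0 t| ≤ ε ^ 2 * Real.exp (1 / 10 ^ 8 * K ^ 10) := by
  have hK := hs.K_pos
  have hε := hs.ε_pos
  obtain ⟨-, hup⟩ := hs.c_zero_rotor_upper hex ht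
  obtain ⟨-, hpos⟩ := hs.c_zero_rotor_pos hex ht
  rw [abs_of_pos hpos]
  refine hup.trans ?_
  -- `K^{-1/2} ≤ 1/(4·10⁸)`
  have hroot : K ^ (-(1 : ℝ) / 2) ≤ 1 / (4 * 10 ^ 8) := by
    rw [show -(1 : ℝ) / 2 = -((1 : ℝ) / 2) by ring, Real.rpow_neg hK.le, ← Real.sqrt_eq_rpow, one_div]
    apply inv_anti₀ (by norm_num)
    rw [show (4 : ℝ) * 10 ^ 8 = Real.sqrt ((4 * 10 ^ 8) ^ 2) by rw [Real.sqrt_sq (by norm_num)]]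
    exact Real.sqrt_le_sqrt (by nlinarith)
  have hexp : Real.exp (4 * K ^ 10 * K ^ (-(1 : ℝ) / 2)) ≤ Real.exp (1 / 10 ^ 8 * K ^ 10) := by
    apply Real.exp_le_exp.2
    have h10 := pow_nonneg hK.le 10
    calc 4 * K ^ 10 * K ^ (-(1 : ℝ) / 2) ≤ 4 * K ^ 10 * (1 / (4 * 10 ^ 8)) := by gcongr
      _ = 1 / 10 ^ 8 * K ^ 10 := by ring
  have hK10 : 2 * ((K ^ 10)⁻¹ * ε ^ 2) ≤ ε ^ 2 := by
    have := hs.inv_K_pow_le_half (n := 10) (by norm_num)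
    nlinarith [sq_nonneg ε]
  calc Real.exp (4 * K ^ 10 * K ^ (-(1 : ℝ) / 2)) * (2 * ((K ^ 10)⁻¹ * ε ^ 2))
      ≤ Real.exp (1 / 10 ^ 8 * K ^ 10) * ε ^ 2 := by gcongr
    _ = _ := mul_comm _ _

/-- **Prop. 6.17 (No exit to coarse scales).** In the parameter regime of §6.7 with, in addition,
`K ≥ 10¹⁸`: `Ẽ₋₁(t) ≤ 100 K⁻¹⁴` for all `t_c ≤ t ≤ τ₁` — all the zero-scale inputs being supplied by
`TaoCascadeZeroScaleCritical.lean` (`t_c ≥ 1/2`, `|c₀| ≤ K⁻¹⁰ε²` and `a₀ ≥ 1 - 2K⁻⁸` before `t_c`)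
and `TaoCascadeZeroScaleTauOne.lean` (`τ₁ ≤ min(T, 3)`, (6.165) `c₀ ≥ K¹⁰⁰ε²` on `I`, (6.181)
`|∂ₜc₀| ≤ 5K¹⁰c₀`, (6.167)). [cite: Tao2016AveragedNS, §6.7 Prop. 6.17 (6.174)] -/
theorem Setting.F_negOne_le_rotor_phase (hs : Setting ε₀ K ε C₁ C₂ C₃ C₄ C₅ n₀ N τ Y F T)
    (hex : ExitTrichotomy ε₀ K Y F T) (hK18 : (10 : ℝ) ^ 18 ≤ K) {t : ℝ}
    (ht : t ∈ Icc (tc K ε Y T) (τone K ε Y T)) : F (-1) t ≤ 100 * (K ^ 14)⁻¹ := by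
  have hK := hs.K_pos
  obtain ⟨_, hτ2, _, hτ4⟩ := hs.τone_bounds hex
  have htc := hs.tc_mem
  have hhalf := hs.half_le_tc hex
  have hP : ∀ s ∈ Icc 0 (tc K ε Y T), SmallC K ε Y s := fun u hu => hs.smallC_of_mem_tc hu
  refine hs.F_negOne_le_of_rotor (L₀ := 5 * K ^ 10) hhalf hτ2 hτ4.le ?_ hP
    (fun u hu => hs.abs_c_zero_rotor_le hex hK18 hu) ?_ ?_ ?_ ht
  · have := pow_nonneg hK.le 10; nlinarith
  · intro u hu
    have h := (hs.a_zero_bounds htc hP hu).1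
    have hK8 : (K ^ 8)⁻¹ ≤ 1 / 2 := hs.inv_K_pow_le_half (by norm_num)
    linarith
  · intro u hu
    have h := hs.c_zero_large hex hu
    exact le_trans (mul_le_mul_of_nonneg_right (pow_le_pow_right₀ hs.one_le_K (by norm_num))
      (sq_nonneg ε)) h
  · intro u hu
    have hK9 : 0 < (K ^ 9)⁻¹ := by positivity
    exact (hs.dc_zero_rotor hex ⟨by linarith [hu.1], hu.2⟩).2.2

/-- On `[t_c, τ₁]` the "backwards flow of energy" value is not reached: `Ẽ₋₁ < K⁻¹⁰(1+ε₀)^{2/10}`.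
[cite: Tao2016AveragedNS, §6.7 Prop. 6.17] -/
theorem Setting.F_negOne_lt_exit_rotor_phase (hs : Setting ε₀ K ε C₁ C₂ C₃ C₄ C₅ n₀ N τ Y F T)
    (hex : ExitTrichotomy ε₀ K Y F T) (hK18 : (10 : ℝ) ^ 18 ≤ K) {t : ℝ}
    (ht : t ∈ Icc (tc K ε Y T) (τone K ε Y T)) :
    F (-1) t < (K ^ 10)⁻¹ * (1 + ε₀) ^ ((2 : ℝ) / 10) := by
  have h := hs.F_negOne_le_rotor_phase hex hK18 ht
  have hK := hs.K_pos
  have hq : 1 ≤ (1 + ε₀) ^ ((2 : ℝ) / 10) := hs.one_le_q_rpow (by norm_num)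
  have hK10 : 0 < (K ^ 10)⁻¹ := by positivity
  have h14 : 100 * (K ^ 14)⁻¹ < (K ^ 10)⁻¹ := by
    have h1 : 100 * (K ^ 14)⁻¹ = 100 * (K ^ 4)⁻¹ * (K ^ 10)⁻¹ := by field_simp
    rw [h1]
    have h4 : (K ^ 4)⁻¹ ≤ 1 / 10 ^ 6 := hs.inv_K_pow_le_inv_ten6 (by norm_num)
    have : 100 * (K ^ 4)⁻¹ < 1 := by linarith
    calc 100 * (K ^ 4)⁻¹ * (K ^ 10)⁻¹ < 1 * (K ^ 10)⁻¹ := by gcongr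
      _ = _ := one_mul _
  calc F (-1) t ≤ 100 * (K ^ 14)⁻¹ := h
    _ < (K ^ 10)⁻¹ := h14
    _ = (K ^ 10)⁻¹ * 1 := (mul_one _).symm
    _ ≤ (K ^ 10)⁻¹ * (1 + ε₀) ^ ((2 : ℝ) / 10) := by gcongr

/-- **(6.175): `τ₁ = t_c + K^{-1/2}`** ("In particular, by Proposition 6.16 we have
`τ₁ = t_c + K^{-1/2}`, and hence the interval `I = [t_c + K⁻⁹, τ₁]` is non-empty"), for `K ≥ 10¹⁸`.
[cite: Tao2016AveragedNS, §6.7 (6.175)] -/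
theorem Setting.τone_eq (hs : Setting ε₀ K ε C₁ C₂ C₃ C₄ C₅ n₀ N τ Y F T)
    (hex : ExitTrichotomy ε₀ K Y F T) (hK18 : (10 : ℝ) ^ 18 ≤ K) :
    τone K ε Y T = tc K ε Y T + K ^ (-(1 : ℝ) / 2) := by
  rcases hs.exit_dichotomy hex with h | h
  · exfalso
    obtain ⟨hτ1, -, -, -⟩ := hs.τone_bounds hex
    have := hs.F_negOne_lt_exit_rotor_phase hex hK18 ⟨hτ1, le_rfl⟩
    exact absurd h (ne_of_lt this)
  · exact h

/-- The interval `I = [t_c + K⁻⁹, τ₁]` is non-empty: `t_c + K⁻⁹ < τ₁` (for `K ≥ 10¹⁸`).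
[cite: Tao2016AveragedNS, §6.7 (6.175)] -/
theorem Setting.tc_add_lt_τone (hs : Setting ε₀ K ε C₁ C₂ C₃ C₄ C₅ n₀ N τ Y F T)
    (hex : ExitTrichotomy ε₀ K Y F T) (hK18 : (10 : ℝ) ^ 18 ≤ K) :
    tc K ε Y T + (K ^ 9)⁻¹ < τone K ε Y T := by
  rw [hs.τone_eq hex hK18]
  have hK := hs.K_pos
  have h1 : (K ^ 9)⁻¹ < K ^ (-(1 : ℝ) / 2) := by
    have h2 : (K ^ 9)⁻¹ ≤ (K ^ 1)⁻¹ * (K ^ 1)⁻¹ := by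
      rw [← mul_inv, ← pow_add]; exact hs.inv_pow_anti (by norm_num)
    have h3 : (K ^ 1)⁻¹ < 1 := by
      rw [pow_one]; exact inv_lt_one_of_one_lt₀ (by linarith [hs.K_large])
    have h4 : (K ^ 1)⁻¹ ≤ K ^ (-(1 : ℝ) / 2) := by
      rw [pow_one, ← Real.rpow_neg_one]
      exact Real.rpow_le_rpow_of_exponent_le hs.one_le_K (by norm_num)
    have h5 : 0 < (K ^ 1)⁻¹ := by positivity
    calc (K ^ 9)⁻¹ ≤ (K ^ 1)⁻¹ * (K ^ 1)⁻¹ := h2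
      _ < (K ^ 1)⁻¹ * 1 := by gcongr
      _ = (K ^ 1)⁻¹ := mul_one _
      _ ≤ _ := h4
  linarith

/-- **(6.179): the improved `a₀`-equation on `[t_c, τ₁]`**: `|∂ₜa₀ + ε⁻²c₀d₀| ≤ 210 K⁻¹³` (the source
writes `O(K⁻¹⁴)`; the input term `K d₋₁² ≤ 2KẼ₋₁` of (6.45) gives `O(K·K⁻¹⁴)`), for `K ≥ 10¹⁸`.
[cite: Tao2016AveragedNS, §6.7 (6.179)] -/
theorem Setting.da_zero_rotor_phase (hs : Setting ε₀ K ε C₁ C₂ C₃ C₄ C₅ n₀ N τ Y F T)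
    (hex : ExitTrichotomy ε₀ K Y F T) (hK18 : (10 : ℝ) ^ 18 ≤ K) {t : ℝ}
    (ht : t ∈ Icc (tc K ε Y T) (τone K ε Y T)) :
    |dY (τ (n₀ - N)) Y 0 0 t + (ε ^ 2)⁻¹ * Y 2 0 t * Y 3 0 t| ≤ 210 * (K ^ 13)⁻¹ := by
  have htT := (hs.mem_rotor hex ht).1
  have h := hs.da_zero htT
  have hF := hs.F_negOne_le_rotor_phase hex hK18 ht
  have hK := hs.K_pos
  have hε := hs.ε_pos
  have hρε := hs.ρ_le_ε
  have hεK := hs.ε_le_K100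
  have h100 : (K ^ 100)⁻¹ ≤ (K ^ 13)⁻¹ := hs.inv_pow_anti (by norm_num)
  have hKF : 2 * K * F (-1) t ≤ 200 * (K ^ 13)⁻¹ := by
    calc 2 * K * F (-1) t ≤ 2 * K * (100 * (K ^ 14)⁻¹) := by gcongr
      _ = 200 * (K ^ 13)⁻¹ := by field_simp; norm_num
  have h13 : 0 < (K ^ 13)⁻¹ := by positivity
  linarith

end RotorPhase

end ZeroScale

end TaoCascade

end Literature.Analysis.FluidPDE
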